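import Literature.Analysis.FluidPDE.ChaeAsymptoticallySelfSimilarProofs
import Literature.Analysis.FluidPDE.ClassicalSolutionRescale
import Literature.Analysis.FluidPDE.LerayHopfForcedOpenStrip
import Literature.Analysis.FluidPDE.KNSSBlowupLimit
import Literature.Analysis.FluidPDE.SelfSimilarProofs
import Literature.Analysis.FluidPDE.LeraySelfSimilarCalculus
import HarnessLib

/-!
# Chae 2007, Theorem 1.5: the blow-up limit is a very weak solution of Leray's system
# (proofs companion, part 2)

Analysis/FluidPDE proofs file (theorems only: no definitions, no named facts), second companion
of `Literature/Analysis/FluidPDE/ChaeAsymptoticallySelfSimilar.lean` (D. Chae, *Nonexistence of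
asymptotically self-similar singularities in the Euler and the Navier–Stokes equations*, Math.
Ann. 338 (2007) 435–449 = arXiv:math/0604234, **Theorem 1.5**, vendored as the named fact
`chae2007_asymptoticallySelfSimilar_local`). The first companion
(`ChaeAsymptoticallySelfSimilarProofs.lean`) proves the radius claim and the similarity variables,
ending with `tendsto_iSup_nsRescale_sub_lerayBackward`: under hypothesis (1.15) the blow-up
rescalings `v_λ = nsRescale λ (v(T + ·, z + ·))` of the classical solution `v` about `(T, z)`
converge, as `λ ↓ 0`, to the backward self-similar field `u_V̄ = lerayBackward ½ 0 V̄`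
(`u_V̄(s, y) = (−s)^{-1/2} V̄(y/√(−s))`) in `L^∞((−1, 0); L^q(B(0, R)))`, for every `R`.

This file PROVES the next step of the printed proof (arXiv p. 8): "Following exactly the same
procedure as in the proof of Theorem 1.4 [p. 7: "Using this convergence, we can pass to the
limit `s → ∞` in the weak formulation of (NS₁)"], we can conclude that `V̄` is a weak solution of
the Leray system (3.6). We note here that `L^q_{loc}(ℝ³)` convergence with `q ∈ [2, ∞)` is enough
to show that `V̄` [is] a weak solution of the Leray system." With only that convergence as
hypothesis (`q ≥ 2`, `V̄` a.e.-strongly measurable, `v` classical on `ℝ³ × (0, T)` with any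
smooth pressure) it establishes that `V̄ ∈ L^q_{loc}` is weakly divergence free and satisfies
Leray's profile system `−ΔV̄ + ½V̄ + ½(y·∇)V̄ + (V̄·∇)V̄ + ∇P̄ = 0` in the sense of distributions
against divergence-free test fields (the *very weak* form; no gradient of `V̄` is asserted —
the printed proof does not provide one):

* `isClassicalNSSolutionOn_nsRescale_translate`, `weakIdentity_nsRescale_translate` — the
  rescalings `v_λ` are classical solutions on `ℝ³ × (−T/λ², 0)` and satisfy the pressure-free
  weak identity against divergence-free test fields on `(−1, 0) × ℝ³` (`λ² ≤ T`);
* `enorm_integral_weakIntegrand_sub_le` — the slice estimate behind "`L^q_{loc}`, `q ≥ 2`, is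
  enough": for the Navier–Stokes integrand `Φ(w) = ⟪w, ∂ₛψ⟫ + ⟪w, (w·∇)ψ⟫ + ⟪w, Δψ⟫`,
  `|∫Φ(f) − ∫Φ(g)| ≤ K‖f − g‖₂(2|B|^{1/2} + ‖f − g‖₂ + 2‖g‖₂)` on a ball `B ⊇ supp ψ(s)`
  (Cauchy–Schwarz; the quadratic term needs exactly `L²_{loc}`);
* `memLp_lerayBackward_restrict_ball`, `memLp_profile_restrict_ball_of_tendsto` — the
  hypothesis forces `u_V̄(s) ∈ L^q(B_R)` for `s ∈ (−1, 0)` and `V̄ ∈ L^q_{loc}(ℝ³)` (even for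
  `q > p`);
* `weakIdentity_lerayBackward_of_tendsto` — **the blow-up limit `u_V̄` is a very weak solution
  of Navier–Stokes on `(−1, 0) × ℝ³`**: its pressure-free pairing against every divergence-free
  test field is a continuous function of time (uniform limit of those of the `v_λ`) with
  vanishing integral;
* `isWeaklyDivFree_lerayBackward_of_tendsto`, `isWeaklyDivFree_profile_of_tendsto` — the slices
  `u_V̄(s)` and the profile `V̄` are weakly divergence free;
* `isSpaceTimeTestOn_selfSimilarTest`, `fderiv_/laplacian_/hasDerivAt_/isDivFree_selfSimilarTest`
  — the self-similar test fields `ψ(s, y) = θ(s)(−s)⁻¹Φ(y/√(−s))` (Chae's change of variables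
  (3.13) performed on the test side) and their calculus;
* `integral_pairing_selfSimilarTest` — **separation of variables**: slice by slice, the pairing
  of `u_V̄` with `ψ` is `θ'(s)∫⟪V̄, Φ⟫ + θ(s)(−s)⁻¹ L(V̄, Φ)` with the Leray functional
  `L(V̄, Φ) = ∫(⟪V̄, ΔΦ⟫ + ⟪V̄, Φ⟫ + ½⟪V̄, (y·∇)Φ⟫ + ⟪V̄, (V̄·∇)Φ⟫)`; `integral_time_selfSimilarTest`,
  `exists_bump_weight_pos` — `∫θ' = 0` and a cut-off with positive weight `∫θ(s)(−s)⁻¹ds`;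
* `lerayVeryWeak_profile_of_tendsto` — **`L(V̄, Φ) = 0` for every divergence-free test field
  `Φ`**: `V̄` is a very weak solution of Leray's system (3.6).

Not in this file: the regularity of very weak `L^p` profiles (needed before the tree's
`necas_ruzicka_sverak_holds` / `tsai_selfsimilar_holds`, which are stated for `C²` profiles
`IsLerayProfile 1 ½`), the suitability of `v` up to the blow-up time, and the ε-regularity step.

## References

* D. Chae, Math. Ann. 338 (2007) 435–449 = arXiv:math/0604234: Theorem 1.5 and its proof
  (arXiv p. 8), proof of Theorem 1.4 (arXiv p. 7), (3.6), (3.13)–(3.14) [Chae2007].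
* J. Nečas, M. Růžička, V. Šverák, Acta Math. 176 (1996) 283–294, (1.4)–(1.5) (the profile
  system) [NecasRuzickaSverak1996].
* G. Koch, N. Nadirashvili, G. Seregin, V. Šverák, Acta Math. 203 (2009) = arXiv:0709.3599, §4
  (ii) and §6 (the pressure-free class of the zoomed solutions; the tree's `KNSSBlowupLimit`)
  [KochNadirashviliSereginSverak2009].
-/

noncomputable section

open _root_.MeasureTheory Set Function Filter Metric TopologicalSpace
open scoped NNReal ENNReal _root_.Topology RealInnerProductSpace Laplacian

namespace Literature.Analysis.FluidPDE

section Rescalings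

variable {T : ℝ} {z : EuclideanSpace ℝ (Fin 3)}
  {v : ℝ → EuclideanSpace ℝ (Fin 3) → EuclideanSpace ℝ (Fin 3)}
  {π : ℝ → EuclideanSpace ℝ (Fin 3) → ℝ}

/-! ### The blow-up rescalings about `(T, z)` -/

/-- **The blow-up rescalings are classical solutions** (Chae 2007, proof of Thm 1.5 with (3.13);
KNSS 2009, §6 (6.2)): if `v` is a classical solution of Navier–Stokes (`ν = 1`, no force) on
`ℝ³ × (0, T)` with pressure `π`, then for `λ > 0` the rescaling
`v_λ(s, y) = λ v(T + λ²s, z + λy)` (`nsRescale λ (v(T + ·, z + ·))`) is a classical solution on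
`ℝ³ × (−T/λ², 0)` with pressure `λ² π(T + λ²s, z + λy)`
(`IsClassicalNSSolutionOn.nsRescale_translate_zero`). [cite: Chae2007, proof of Thm 1.5, (3.13) (arXiv p. 8)] -/
theorem isClassicalNSSolutionOn_nsRescale_translate
    (hv : IsClassicalNSSolutionOn (Ioo 0 T) 1 0 v π) {l : ℝ} (hl : 0 < l) :
    IsClassicalNSSolutionOn (Ioo (-(T / l ^ 2)) 0) 1 0
      (nsRescale l (fun τ x => v (T + τ) (z + x)))
      (fun s y => l ^ 2 * π (T + l ^ 2 * s) (z + l • y)) := by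
  have key := hv.nsRescale_translate_zero hl T z
  have hset : (fun r => T + l ^ 2 * r) ⁻¹' Ioo 0 T = Ioo (-(T / l ^ 2)) 0 := by
    have hl2 : 0 < l ^ 2 := by positivity
    ext r
    simp only [mem_preimage, mem_Ioo]
    constructor
    · rintro ⟨h1, h2⟩
      refine ⟨?_, by nlinarith⟩
      rw [neg_lt, lt_div_iff₀ hl2]
      nlinarith
    · rintro ⟨h1, h2⟩
      rw [neg_lt, lt_div_iff₀ hl2] at h1
      exact ⟨by nlinarith, by nlinarith⟩
  rw [hset] at key
  exact key

/-- **The rescalings satisfy the pressure-free weak identity on `(−1, 0) × ℝ³`** for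
`0 < λ`, `λ² ≤ T` (then `(−1, 0) ⊆ (−T/λ², 0)`): for every smooth compactly supported test
field `ψ` on the slab with divergence-free slices,
`∫_{−1}^0 ∫ (⟪v_λ, ∂ₛψ⟫ + ⟪v_λ, (v_λ·∇)ψ⟫ + ⟪v_λ, Δψ⟫) = 0`
(`IsClassicalNSSolutionOn.weakIdentity_test_Ioo`: the pressure pairs to zero against
divergence-free fields). [cite: Chae2007, proof of Thm 1.4 ("the weak formulation of (NS₁)", arXiv p. 7)] -/
theorem weakIdentity_nsRescale_translate
    (hv : IsClassicalNSSolutionOn (Ioo 0 T) 1 0 v π) {l : ℝ} (hl : 0 < l) (hlT : l ^ 2 ≤ T)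
    {ψ : ℝ → EuclideanSpace ℝ (Fin 3) → EuclideanSpace ℝ (Fin 3)}
    (hψ : IsSpaceTimeTestOn (slab (EuclideanSpace ℝ (Fin 3)) (Ioo (-1) 0) isOpen_Ioo) ψ)
    (hdiv : ∀ t, VectorCalculus.IsDivFree (ψ t)) :
    ∫ s in Ioo (-1 : ℝ) 0, ∫ y,
      (⟪nsRescale l (fun τ x => v (T + τ) (z + x)) s y, timeDeriv ψ s y⟫ +
        ⟪nsRescale l (fun τ x => v (T + τ) (z + x)) s y,
          convect (nsRescale l (fun τ x => v (T + τ) (z + x)) s) (ψ s) y⟫ +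
        1 * ⟪nsRescale l (fun τ x => v (T + τ) (z + x)) s y, Δ (ψ s) y⟫) = 0 := by
  have hsub : Ioo (-1 : ℝ) 0 ⊆ Ioo (-(T / l ^ 2)) 0 := by
    refine Ioo_subset_Ioo ?_ le_rfl
    rw [neg_le_neg_iff, le_div_iff₀ (by positivity)]
    linarith
  have h1 := (isClassicalNSSolutionOn_nsRescale_translate (z := z) hv hl).mono hsub
    (uniqueDiffOn_Ioo (-1) 0)
  have key := h1.weakIdentity_test_Ioo hψ hdiv
  simpa using key

end Rescalings



section SliceEstimate

variable {E : Type*} [NormedAddCommGroup E] [InnerProductSpace ℝ E] [MeasurableSpace E]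

/-- Cauchy–Schwarz for an inner-product pairing in `L¹`:
`∫⁻ ‖⟪f, g⟫‖ₑ ≤ ‖f‖_{L²} ‖g‖_{L²}`. [folklore] -/
theorem lintegral_enorm_inner_le_eLpNorm_two_mul (μ : Measure E) {f g : E → E}
    (hf : AEStronglyMeasurable f μ) (hg : AEStronglyMeasurable g μ) :
    ∫⁻ y, ‖⟪f y, g y⟫‖ₑ ∂μ ≤ eLpNorm f 2 μ * eLpNorm g 2 μ := by
  have h := eLpNorm_le_eLpNorm_mul_eLpNorm'_of_norm (p := 2) (q := 2) (r := 1) hf hg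
    (fun a b : E => (inner ℝ a b : ℝ)) 1 (Eventually.of_forall fun y => by
      simpa using norm_inner_le_norm (𝕜 := ℝ) (f y) (g y))
  simpa [eLpNorm_one_eq_lintegral_enorm] using h

/-- The `L²` norm of `y ↦ B y (w y)` is at most `K ‖w‖_{L²}` when `‖B y‖ ≤ K`. [folklore] -/
theorem eLpNorm_clm_apply_le_ofReal_mul {μ : Measure E} {B : E → E →L[ℝ] E} {w : E → E} {K : ℝ}
    (hBK : ∀ y, ‖B y‖ ≤ K) (p : ℝ≥0∞) :
    eLpNorm (fun y => B y (w y)) p μ ≤ ENNReal.ofReal K * eLpNorm w p μ :=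
  eLpNorm_le_mul_eLpNorm_of_ae_le_mul (Eventually.of_forall fun y =>
    ((B y).le_opNorm (w y)).trans (mul_le_mul_of_nonneg_right (hBK y) (norm_nonneg _))) p

/-- **The slice estimate.** For the pressure-free Navier–Stokes integrand
`Φ(w) = ⟪w, a⟫ + ⟪w, B(w)⟫ + ⟪w, c⟫` built from slice data `a, B, c` bounded by `K`
(`a = ∂ₜψ(s)`, `B = Dψ(s)`, `c = Δψ(s)`), on a finite measure `μ` (Lebesgue measure on a
ball containing the support of `ψ(s)`):
`‖∫ Φ(f) − ∫ Φ(g)‖ ≤ K ‖f − g‖₂ (2 μ(E)^{1/2} + ‖f − g‖₂ + 2‖g‖₂)`, from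
`Φ(f) − Φ(g) = ⟪f−g, a + c⟫ + ⟪f−g, B(f−g)⟫ + ⟪f−g, B g⟫ + ⟪g, B(f−g)⟫` and Cauchy–Schwarz.
[folklore] -/
theorem enorm_integral_weakIntegrand_sub_le (μ : Measure E) [IsFiniteMeasure μ]
    {f g a c : E → E} {B : E → E →L[ℝ] E} {K : ℝ}
    (hf : AEStronglyMeasurable f μ) (hg : AEStronglyMeasurable g μ)
    (ha : AEStronglyMeasurable a μ) (hB : AEStronglyMeasurable B μ)
    (hc : AEStronglyMeasurable c μ)
    (haK : ∀ y, ‖a y‖ ≤ K) (hBK : ∀ y, ‖B y‖ ≤ K) (hcK : ∀ y, ‖c y‖ ≤ K)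
    (hfi : Integrable (fun y => ⟪f y, a y⟫ + ⟪f y, B y (f y)⟫ + ⟪f y, c y⟫) μ)
    (hgi : Integrable (fun y => ⟪g y, a y⟫ + ⟪g y, B y (g y)⟫ + ⟪g y, c y⟫) μ) :
    ‖(∫ y, (⟪f y, a y⟫ + ⟪f y, B y (f y)⟫ + ⟪f y, c y⟫) ∂μ) -
        ∫ y, (⟪g y, a y⟫ + ⟪g y, B y (g y)⟫ + ⟪g y, c y⟫) ∂μ‖ₑ ≤
      ENNReal.ofReal K * eLpNorm (f - g) 2 μ *
        (2 * μ univ ^ (1 / 2 : ℝ) + eLpNorm (f - g) 2 μ + 2 * eLpNorm g 2 μ) := by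
  -- measurability bookkeeping
  have happ : Continuous fun p : (E →L[ℝ] E) × E => p.1 p.2 :=
    (isBoundedBilinearMap_apply (𝕜 := ℝ) (E := E) (F := E)).continuous
  have hfg : AEStronglyMeasurable (f - g) μ := hf.sub hg
  have hBfg : AEStronglyMeasurable (fun y => B y ((f - g) y)) μ :=
    happ.comp_aestronglyMeasurable (hB.prodMk hfg)
  have hBg : AEStronglyMeasurable (fun y => B y (g y)) μ :=
    happ.comp_aestronglyMeasurable (hB.prodMk hg)
  have hac : AEStronglyMeasurable (fun y => a y + c y) μ := ha.add hc
  -- the difference of the integrals is the integral of the difference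
  rw [← integral_sub hfi hgi]
  refine (enorm_integral_le_lintegral_enorm _).trans ?_
  -- pointwise decomposition
  have hpt : ∀ y, (⟪f y, a y⟫ + ⟪f y, B y (f y)⟫ + ⟪f y, c y⟫) -
      (⟪g y, a y⟫ + ⟪g y, B y (g y)⟫ + ⟪g y, c y⟫) =
      ⟪(f - g) y, a y + c y⟫ + ⟪(f - g) y, B y ((f - g) y)⟫ + ⟪(f - g) y, B y (g y)⟫ +
        ⟪g y, B y ((f - g) y)⟫ := by
    intro y
    simp only [Pi.sub_apply, map_sub, inner_sub_left, inner_sub_right, inner_add_right]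
    ring
  have hle : ∀ y, ‖(⟪f y, a y⟫ + ⟪f y, B y (f y)⟫ + ⟪f y, c y⟫) -
      (⟪g y, a y⟫ + ⟪g y, B y (g y)⟫ + ⟪g y, c y⟫)‖ₑ ≤
      ‖⟪(f - g) y, a y + c y⟫‖ₑ + ‖⟪(f - g) y, B y ((f - g) y)⟫‖ₑ +
        ‖⟪(f - g) y, B y (g y)⟫‖ₑ + ‖⟪g y, B y ((f - g) y)⟫‖ₑ := by
    intro y
    rw [hpt y]
    exact (enorm_add_le _ _).trans (add_le_add ((enorm_add_le _ _).trans
      (add_le_add (enorm_add_le _ _) le_rfl)) le_rfl)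
  refine (lintegral_mono fun y => hle y).trans ?_
  rw [lintegral_add_right' _ (hg.inner hBfg).enorm, lintegral_add_right' _ (hfg.inner hBg).enorm,
    lintegral_add_right' _ (hfg.inner hBfg).enorm]
  -- the four Cauchy–Schwarz bounds
  have h1 := lintegral_enorm_inner_le_eLpNorm_two_mul μ hfg hac
  have h2 := lintegral_enorm_inner_le_eLpNorm_two_mul μ hfg hBfg
  have h3 := lintegral_enorm_inner_le_eLpNorm_two_mul μ hfg hBg
  have h4 := lintegral_enorm_inner_le_eLpNorm_two_mul μ hg hBfg
  have hB1 := eLpNorm_clm_apply_le_ofReal_mul (μ := μ) (w := f - g) hBK 2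
  have hB2 := eLpNorm_clm_apply_le_ofReal_mul (μ := μ) (w := g) hBK 2
  have hac2 : eLpNorm (fun y => a y + c y) 2 μ ≤ 2 * ENNReal.ofReal K * μ univ ^ (1 / 2 : ℝ) := by
    have hb : ∀ᵐ y ∂μ, ‖a y + c y‖ ≤ 2 * K := Eventually.of_forall fun y =>
      (norm_add_le _ _).trans (by linarith [haK y, hcK y])
    refine (eLpNorm_le_of_ae_bound hb).trans (le_of_eq ?_)
    rw [ENNReal.ofReal_mul (by norm_num), ENNReal.ofReal_ofNat]
    simp only [ENNReal.toReal_ofNat, one_div]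
    ring
  set e := eLpNorm (f - g) 2 μ
  set m := eLpNorm g 2 μ
  set k := ENNReal.ofReal K
  calc ∫⁻ y, ‖⟪(f - g) y, a y + c y⟫‖ₑ ∂μ + ∫⁻ y, ‖⟪(f - g) y, B y ((f - g) y)⟫‖ₑ ∂μ +
        ∫⁻ y, ‖⟪(f - g) y, B y (g y)⟫‖ₑ ∂μ + ∫⁻ y, ‖⟪g y, B y ((f - g) y)⟫‖ₑ ∂μ
      ≤ e * (2 * k * μ univ ^ (1 / 2 : ℝ)) + e * (k * e) + e * (k * m) + m * (k * e) :=
        add_le_add (add_le_add (add_le_add (h1.trans (mul_le_mul' le_rfl hac2))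
          (h2.trans (mul_le_mul' le_rfl hB1))) (h3.trans (mul_le_mul' le_rfl hB2)))
          (h4.trans (mul_le_mul' le_rfl hB1))
    _ = k * e * (2 * μ univ ^ (1 / 2 : ℝ) + e + 2 * m) := by ring

end SliceEstimate



section TestFieldSupport

variable {E : Type*} [NormedAddCommGroup E] [InnerProductSpace ℝ E] [FiniteDimensional ℝ E]
  [MeasurableSpace E] [BorelSpace E]

omit [MeasurableSpace E] [BorelSpace E] [FiniteDimensional ℝ E] in
/-- A space–time test field is supported in `ℝ × B(0, R)` for some `R > 0`. [folklore] -/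
theorem IsSpaceTimeTestOn.exists_tsupport_subset_ball {F : Type*} [NormedAddCommGroup F]
    [NormedSpace ℝ F] {Q : Opens (ℝ × E)} {ψ : ℝ → E → F} (hψ : IsSpaceTimeTestOn Q ψ) :
    ∃ R : ℝ, 0 < R ∧ tsupport (uncurry ψ) ⊆ univ ×ˢ ball (0 : E) R := by
  obtain ⟨R, hR⟩ := (hψ.hasCompactSupport.image continuous_snd).isBounded.subset_ball_lt 0 0
  exact ⟨R, hR.1, fun p hp => ⟨mem_univ _, hR.2 (mem_image_of_mem _ hp)⟩⟩

omit [MeasurableSpace E] [BorelSpace E] [InnerProductSpace ℝ E] [FiniteDimensional ℝ E] in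
/-- The slice supports of a space–time field lie in the slices of its support. [folklore] -/
theorem tsupport_slice_subset_preimage_tsupport [NormedSpace ℝ E] {F : Type*} [NormedAddCommGroup F]
    (ψ : ℝ → E → F) (t : ℝ) :
    tsupport (ψ t) ⊆ (fun x => (t, x)) ⁻¹' tsupport (uncurry ψ) := by
  refine closure_minimal (fun x hx => subset_closure ?_)
    ((isClosed_tsupport _).preimage (Continuous.prodMk_right t))
  exact hx

omit [MeasurableSpace E] [BorelSpace E] in
/-- Off `ℝ × B(0, R) ⊇ supp ψ` the pressure-free Navier–Stokes integrand against `ψ` vanishes,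
whatever the velocity. [folklore] -/
theorem weakIntegrand_eq_zero_of_notMem_ball {ψ : ℝ → E → E}
    {R : ℝ} (hR : tsupport (uncurry ψ) ⊆ univ ×ˢ ball (0 : E) R)
    (w : E → E) (ν t : ℝ) {x : E} (hx : x ∉ ball (0 : E) R) :
    ⟪w x, timeDeriv ψ t x⟫ + ⟪w x, convect w (ψ t) x⟫ + ν * ⟪w x, Δ (ψ t) x⟫ = 0 := by
  have hnot : (t, x) ∉ tsupport (uncurry ψ) := fun h => hx (hR h).2
  have h1 : timeDeriv ψ t x = 0 := IsSpaceTimeTestOn.timeDeriv_eq_zero_of_notMem hnot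
  have h2 : fderiv ℝ (ψ t) x = 0 := IsSpaceTimeTestOn.fderiv_slice_eq_zero_of_notMem hnot
  have hx' : x ∉ tsupport (ψ t) := fun h => hnot (tsupport_slice_subset_preimage_tsupport ψ t h)
  have h3 : Δ (ψ t) x = 0 := laplacian_eq_zero_of_notMem_tsupport hx'
  rw [h1, convect_apply, h2, h3]
  simp

/-- **Continuity in time of the pressure-free pairing** of a field `W`, continuous on an open
slab `(A, B) × E`, against a space–time test field `ψ` on that slab: the integrand is jointly
continuous on `ℝ × E` (continuous on the slab, zero near every point off the support of `ψ`)
and uniformly compactly supported in space. [folklore] -/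
theorem continuous_integral_weakIntegrand {A B ν : ℝ} {W : ℝ → E → E} {ψ : ℝ → E → E}
    (hW : ContinuousOn (uncurry W) (Ioo A B ×ˢ univ))
    (hψ : IsSpaceTimeTestOn (slab E (Ioo A B) isOpen_Ioo) ψ) :
    Continuous fun t => ∫ x, (⟪W t x, timeDeriv ψ t x⟫ + ⟪W t x, convect (W t) (ψ t) x⟫ +
      ν * ⟪W t x, Δ (ψ t) x⟫) := by
  obtain ⟨R, -, hR⟩ := hψ.exists_tsupport_subset_ball
  have hψ' : IsSpaceTimeTestOn (⊤ : Opens (ℝ × E)) ψ := hψ.mono le_top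
  have hc1 : Continuous (uncurry (timeDeriv ψ)) := hψ'.timeDeriv_top.continuous_uncurry
  have hc2 : Continuous (uncurry fun t x => fderiv ℝ (ψ t) x) := hψ'.fderiv_top.continuous_uncurry
  have hc3 : Continuous (uncurry fun t => Δ (ψ t)) := hψ'.laplacian_top.continuous_uncurry
  set G : ℝ × E → ℝ := fun p => ⟪W p.1 p.2, timeDeriv ψ p.1 p.2⟫ +
    ⟪W p.1 p.2, convect (W p.1) (ψ p.1) p.2⟫ + ν * ⟪W p.1 p.2, Δ (ψ p.1) p.2⟫ with hG
  -- continuity on the open slab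
  have hslab : IsOpen (Ioo A B ×ˢ (univ : Set E)) := isOpen_Ioo.prod isOpen_univ
  have hGon : ContinuousOn G (Ioo A B ×ˢ univ) := by
    have happ : Continuous fun p : (E →L[ℝ] E) × E => p.1 p.2 :=
      (isBoundedBilinearMap_apply (𝕜 := ℝ) (E := E) (F := E)).continuous
    have h2 : ContinuousOn (fun p : ℝ × E => fderiv ℝ (ψ p.1) p.2 (W p.1 p.2)) (Ioo A B ×ˢ univ) :=
      happ.comp_continuousOn (hc2.continuousOn.prodMk hW)
    simp only [hG, convect_apply]
    exact ((hW.inner hc1.continuousOn).add (hW.inner h2)).add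
      ((hW.inner hc3.continuousOn).const_smul ν)
  -- joint continuity on `ℝ × E`
  have hGc : Continuous G := by
    rw [continuous_iff_continuousAt]
    intro p
    by_cases hp : p ∈ tsupport (uncurry ψ)
    · have hp' : p ∈ Ioo A B ×ˢ (univ : Set E) := by
        have := hψ.tsupport_subset hp
        simpa [mem_slab] using this
      exact hGon.continuousAt (hslab.mem_nhds hp')
    · have hnear : ∀ᶠ p' in 𝓝 p, p' ∉ tsupport (uncurry ψ) :=
        (isClosed_tsupport _).isOpen_compl.mem_nhds hp
      have hzero : G =ᶠ[𝓝 p] fun _ => 0 := by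
        filter_upwards [hnear] with p' hp'
        have h1 : timeDeriv ψ p'.1 p'.2 = 0 := IsSpaceTimeTestOn.timeDeriv_eq_zero_of_notMem hp'
        have h2 : fderiv ℝ (ψ p'.1) p'.2 = 0 :=
          IsSpaceTimeTestOn.fderiv_slice_eq_zero_of_notMem hp'
        have hx' : p'.2 ∉ tsupport (ψ p'.1) := fun h => hp' (tsupport_slice_subset_preimage_tsupport ψ p'.1 h)
        have h3 : Δ (ψ p'.1) p'.2 = 0 := laplacian_eq_zero_of_notMem_tsupport hx'
        simp only [hG, convect_apply, h1, h2, h3]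
        simp
      exact (continuousAt_const.congr hzero.symm)
  -- the integral over `E` is the integral over the closed ball
  have heq : (fun t => ∫ x, (⟪W t x, timeDeriv ψ t x⟫ + ⟪W t x, convect (W t) (ψ t) x⟫ +
      ν * ⟪W t x, Δ (ψ t) x⟫)) = fun t => ∫ x in closedBall (0 : E) R, G (t, x) := by
    funext t
    rw [setIntegral_eq_integral_of_forall_compl_eq_zero]
    intro x hx
    exact weakIntegrand_eq_zero_of_notMem_ball hR (W t) ν t fun h => hx (ball_subset_closedBall h)
  rw [heq]
  exact continuous_parametric_integral_of_continuous (by exact hGc)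
    (isCompact_closedBall (0 : E) R)

end TestFieldSupport

section Measurability

/-- The slices of the backward self-similar field of an a.e.-strongly measurable profile are
a.e.-strongly measurable (dilations are quasi-measure-preserving). [folklore] -/
theorem aestronglyMeasurable_lerayBackward
    {V : EuclideanSpace ℝ (Fin 3) → EuclideanSpace ℝ (Fin 3)} (hV : AEStronglyMeasurable V volume)
    (a T t : ℝ) : AEStronglyMeasurable (lerayBackward a T V t) volume := by
  set c : ℝ := (Real.sqrt (2 * a * (T - t)))⁻¹ with hc
  have heq : lerayBackward a T V t = fun x => c • V (c • x) := by
    funext x; simp [lerayBackward_apply, hc]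
  rw [heq]
  rcases eq_or_ne c 0 with h0 | h0
  · simp [h0, aestronglyMeasurable_const]
  · exact (hV.comp_quasiMeasurePreserving
      (Measure.quasiMeasurePreserving_smul volume h0)).const_smul c

end Measurability


section Core

variable {T : ℝ} {z : EuclideanSpace ℝ (Fin 3)} {q : ℝ≥0}
  {v : ℝ → EuclideanSpace ℝ (Fin 3) → EuclideanSpace ℝ (Fin 3)}
  {π : ℝ → EuclideanSpace ℝ (Fin 3) → ℝ}
  {V : EuclideanSpace ℝ (Fin 3) → EuclideanSpace ℝ (Fin 3)}

set_option maxHeartbeats 400000 in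
/-- **The blow-up limit is a very weak solution** (Chae 2007, proof of Thm 1.5, arXiv p. 8:
"Following exactly the same procedure as in the proof of Theorem 1.4 … we can pass to the limit
… in the weak formulation … `L^q_{loc}(ℝ³)` convergence with `q ∈ [2, ∞)` is enough"). Let `v`
be a classical solution of Navier–Stokes (`ν = 1`, no force) on `ℝ³ × (0, T)`, `q ≥ 2`, `V`
a.e.-strongly measurable, and suppose the blow-up rescalings `v_λ = nsRescale λ (v(T + ·, z + ·))`
converge to the backward self-similar field `u_V = lerayBackward ½ 0 V` in
`L^∞((−1, 0); L^q(B(0, R)))` for every `R` as `λ ↓ 0` (the conclusion of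
`tendsto_iSup_nsRescale_sub_lerayBackward` under Chae's hypothesis (1.15) for all `R`). Then
`u_V` satisfies the pressure-free weak form of the Navier–Stokes equations on `(−1, 0) × ℝ³`:
for every smooth compactly supported test field `ψ` on the slab with divergence-free slices,
`∫_{−1}^0 ∫ (⟪u_V, ∂ₛψ⟫ + ⟪u_V, (u_V·∇)ψ⟫ + ⟪u_V, Δψ⟫) dy ds = 0`. Proof: the `v_λ` are classical
solutions on `(−T/λ², 0) ⊇ (−1, 0)` (`λ² ≤ T`), hence satisfy the identity; slice by slice the
difference of the pairings is `≤ K‖v_λ(s) − u_V(s)‖₂(2|B_R|^{1/2} + ‖v_λ(s) − u_V(s)‖₂ + 2‖u_V(s)‖₂)`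
(Cauchy–Schwarz on the ball `B_R ⊇ supp ψ(s)`, `L^q(B_R) ⊂ L²(B_R)`), uniformly small in `s`.
[cite: Chae2007, proof of Thm 1.5 (arXiv p. 8), with proof of Thm 1.4 (p. 7)] -/
theorem weakIdentity_lerayBackward_of_tendsto (hT : 0 < T)
    (hv : IsClassicalNSSolutionOn (Ioo 0 T) 1 0 v π) (hq : 2 ≤ q)
    (hV : AEStronglyMeasurable V volume)
    (hlim : ∀ R : ℝ, 0 < R → Tendsto (fun l : ℝ => ⨆ s ∈ Ioo (-1 : ℝ) 0, eLpNorm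
        (fun y => nsRescale l (fun τ x => v (T + τ) (z + x)) s y - lerayBackward (1 / 2) 0 V s y)
        (q : ℝ≥0∞) (volume.restrict (ball 0 R))) (𝓝[>] 0) (𝓝 0))
    {ψ : ℝ → EuclideanSpace ℝ (Fin 3) → EuclideanSpace ℝ (Fin 3)}
    (hψ : IsSpaceTimeTestOn (slab (EuclideanSpace ℝ (Fin 3)) (Ioo (-1) 0) isOpen_Ioo) ψ)
    (hdiv : ∀ t, VectorCalculus.IsDivFree (ψ t)) :
    (Continuous fun s => ∫ y, (⟪lerayBackward (1 / 2) 0 V s y, timeDeriv ψ s y⟫ +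
        ⟪lerayBackward (1 / 2) 0 V s y, convect (lerayBackward (1 / 2) 0 V s) (ψ s) y⟫ +
        ⟪lerayBackward (1 / 2) 0 V s y, Δ (ψ s) y⟫)) ∧
    ∫ s in Ioo (-1 : ℝ) 0, ∫ y, (⟪lerayBackward (1 / 2) 0 V s y, timeDeriv ψ s y⟫ +
        ⟪lerayBackward (1 / 2) 0 V s y, convect (lerayBackward (1 / 2) 0 V s) (ψ s) y⟫ +
        ⟪lerayBackward (1 / 2) 0 V s y, Δ (ψ s) y⟫) = 0 := by
  -- ### abbreviations
  set w : ℝ → ℝ → EuclideanSpace ℝ (Fin 3) → EuclideanSpace ℝ (Fin 3) :=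
    fun l => nsRescale l (fun τ x => v (T + τ) (z + x)) with hw
  set u : ℝ → EuclideanSpace ℝ (Fin 3) → EuclideanSpace ℝ (Fin 3) := lerayBackward (1 / 2) 0 V
    with hu
  set Φ : (EuclideanSpace ℝ (Fin 3) → EuclideanSpace ℝ (Fin 3)) → ℝ → EuclideanSpace ℝ (Fin 3) → ℝ :=
    fun f s y => ⟪f y, timeDeriv ψ s y⟫ + ⟪f y, convect f (ψ s) y⟫ + ⟪f y, Δ (ψ s) y⟫ with hΦ
  set F : (ℝ → EuclideanSpace ℝ (Fin 3) → EuclideanSpace ℝ (Fin 3)) → ℝ → ℝ :=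
    fun W s => ∫ y, Φ (W s) s y with hF
  change (Continuous (F u)) ∧ ∫ s in Ioo (-1 : ℝ) 0, F u s = 0
  -- ### supports and bounds of the test field
  obtain ⟨a', b, ha', ha'b, hb0, hsupp⟩ := hψ.exists_time_support_Ioo (by norm_num)
  obtain ⟨R, hR0, hR⟩ := hψ.exists_tsupport_subset_ball
  have hψ' : IsSpaceTimeTestOn (⊤ : Opens (ℝ × EuclideanSpace ℝ (Fin 3))) ψ := hψ.mono le_top
  obtain ⟨K₁, hK₁0, hK₁⟩ := hψ'.timeDeriv_top.exists_norm_le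
  obtain ⟨K₂, hK₂0, hK₂⟩ := hψ'.fderiv_top.exists_norm_le
  obtain ⟨K₃, hK₃0, hK₃⟩ := hψ'.laplacian_top.exists_norm_le
  set K : ℝ := max K₁ (max K₂ K₃) with hK
  have hKa : ∀ s y, ‖timeDeriv ψ s y‖ ≤ K := fun s y => (hK₁ s y).trans (le_max_left _ _)
  have hKB : ∀ s y, ‖fderiv ℝ (ψ s) y‖ ≤ K := fun s y =>
    (hK₂ s y).trans ((le_max_left _ _).trans (le_max_right _ _))
  have hKc : ∀ s y, ‖Δ (ψ s) y‖ ≤ K := fun s y =>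
    (hK₃ s y).trans ((le_max_right _ _).trans (le_max_right _ _))
  have hc1 : Continuous (uncurry (timeDeriv ψ)) := hψ'.timeDeriv_top.continuous_uncurry
  have hc2 : Continuous (uncurry fun t x => fderiv ℝ (ψ t) x) := hψ'.fderiv_top.continuous_uncurry
  have hc3 : Continuous (uncurry fun t => Δ (ψ t)) := hψ'.laplacian_top.continuous_uncurry
  have hIcc : Icc a' b ⊆ Ioo (-1 : ℝ) 0 := fun s hs => ⟨ha'.trans_le hs.1, hs.2.trans_lt hb0⟩
  -- ### the measure on the ball
  set μ : Measure (EuclideanSpace ℝ (Fin 3)) := volume.restrict (ball 0 R) with hμ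
  haveI hμfin : IsFiniteMeasure μ := by
    rw [hμ]; exact isFiniteMeasure_restrict.2 measure_ball_lt_top.ne
  have hΦzero : ∀ (f : EuclideanSpace ℝ (Fin 3) → EuclideanSpace ℝ (Fin 3)) (s : ℝ) (y),
      y ∉ ball (0 : EuclideanSpace ℝ (Fin 3)) R → Φ f s y = 0 := by
    intro f s y hy
    have := weakIntegrand_eq_zero_of_notMem_ball hR f 1 s hy
    simpa only [hΦ, one_mul] using this
  have hFμ : ∀ (W : ℝ → EuclideanSpace ℝ (Fin 3) → EuclideanSpace ℝ (Fin 3)) (s : ℝ),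
      F W s = ∫ y, Φ (W s) s y ∂μ := by
    intro W s
    simp only [hF, hμ]
    rw [setIntegral_eq_integral_of_forall_compl_eq_zero fun y hy => hΦzero (W s) s y hy]
  -- off the time support every pairing vanishes
  have hFzero : ∀ (W : ℝ → EuclideanSpace ℝ (Fin 3) → EuclideanSpace ℝ (Fin 3)) (s : ℝ),
      s ∉ Icc a' b → F W s = 0 := by
    intro W s hs
    simp only [hF, hΦ]
    have : ∀ y, ⟪W s y, timeDeriv ψ s y⟫ + ⟪W s y, convect (W s) (ψ s) y⟫ + ⟪W s y, Δ (ψ s) y⟫ = 0 := by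
      intro y
      have := weakIntegrand_eq_zero_of_notMem hsupp hs (W s) 1 y
      simpa only [one_mul] using this
    simp only [this, integral_zero]
  -- ### Step 1: the rescalings are classical on `(-T/λ², 0) ⊇ [a', b]`, their pairings vanish
  have hslab : ∀ {l : ℝ}, 0 < l → l ^ 2 ≤ T → Ioo (-1 : ℝ) 0 ⊆ Ioo (-(T / l ^ 2)) 0 := by
    intro l hl hlT
    refine Ioo_subset_Ioo ?_ le_rfl
    rw [neg_le_neg_iff, le_div_iff₀ (by positivity)]
    linarith
  have hwcl : ∀ {l : ℝ}, 0 < l →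
      IsClassicalNSSolutionOn (Ioo (-(T / l ^ 2)) 0) 1 0 (w l)
        (fun s y => l ^ 2 * π (T + l ^ 2 * s) (z + l • y)) := fun hl =>
    isClassicalNSSolutionOn_nsRescale_translate hv hl
  have hwcont : ∀ {l : ℝ}, 0 < l → l ^ 2 ≤ T →
      ContinuousOn (uncurry (w l)) (Ioo (-1 : ℝ) 0 ×ˢ univ) := fun hl hlT =>
    (hwcl hl).smooth_velocity.continuousOn.mono (prod_mono (hslab hl hlT) Subset.rfl)
  have hwslice : ∀ {l : ℝ}, 0 < l → l ^ 2 ≤ T → ∀ s ∈ Ioo (-1 : ℝ) 0, Continuous (w l s) := by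
    intro l hl hlT s hs
    exact ((hwcl hl).contDiff_velocity (hslab hl hlT hs)).continuous
  have hFw0 : ∀ {l : ℝ}, 0 < l → l ^ 2 ≤ T → ∫ s in Ioo (-1 : ℝ) 0, F (w l) s = 0 := by
    intro l hl hlT
    have := weakIdentity_nsRescale_translate (z := z) hv hl hlT hψ hdiv
    simpa only [hF, hΦ, hw, one_mul] using this
  have hFwcont : ∀ {l : ℝ}, 0 < l → l ^ 2 ≤ T → Continuous (F (w l)) := by
    intro l hl hlT
    have := continuous_integral_weakIntegrand (ν := 1) (hwcont hl hlT) hψ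
    simpa only [hF, hΦ, one_mul] using this
  -- ### Step 2: the deviation in `L²(B_R)`, uniformly in `s`, tends to zero
  set D2 : ℝ → ℝ≥0∞ := fun l => ⨆ s ∈ Ioo (-1 : ℝ) 0, eLpNorm (w l s - u s) 2 μ with hD2
  have hmeas_u : ∀ s, AEStronglyMeasurable (u s) volume := fun s =>
    aestronglyMeasurable_lerayBackward hV (1 / 2) 0 s
  have hev : ∀ᶠ l in 𝓝[>] (0 : ℝ), 0 < l ∧ l ^ 2 ≤ T := by
    have h1 : ∀ᶠ l in 𝓝[>] (0 : ℝ), 0 < l := self_mem_nhdsWithin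
    have h2 : ∀ᶠ l in 𝓝 (0 : ℝ), l ^ 2 ≤ T := by
      have ht : Tendsto (fun l : ℝ => l ^ 2) (𝓝 0) (𝓝 0) := by
        simpa using ((continuous_pow 2).tendsto (0 : ℝ))
      exact (ht.eventually (Iic_mem_nhds hT))
    exact h1.and (mem_nhdsWithin_of_mem_nhds h2)
  have hD2lim : Tendsto D2 (𝓝[>] 0) (𝓝 0) := by
    set C : ℝ≥0∞ := μ univ ^ (1 / (2 : ℝ≥0∞).toReal - 1 / ((q : ℝ≥0∞)).toReal) with hC
    have hCtop : C ≠ ∞ := by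
      rw [hC]
      refine ENNReal.rpow_ne_top_of_nonneg ?_ (measure_ne_top μ _)
      have hq' : (2 : ℝ) ≤ (q : ℝ) := by exact_mod_cast hq
      have hqpos : (0 : ℝ) < q := by linarith
      simp only [ENNReal.toReal_ofNat, ENNReal.coe_toReal, sub_nonneg]
      rw [one_div_le_one_div hqpos (by norm_num)]
      exact hq'
    have hle : ∀ᶠ l in 𝓝[>] (0 : ℝ), D2 l ≤ (⨆ s ∈ Ioo (-1 : ℝ) 0, eLpNorm (w l s - u s)
        (q : ℝ≥0∞) μ) * C := by
      filter_upwards [hev] with l hl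
      refine iSup₂_le fun s hs => ?_
      have hq2 : (2 : ℝ≥0∞) ≤ (q : ℝ≥0∞) := by exact_mod_cast hq
      refine (eLpNorm_le_eLpNorm_mul_rpow_measure_univ hq2
        (((hwslice hl.1 hl.2 s hs).aestronglyMeasurable.sub (hmeas_u s)).restrict)).trans ?_
      exact mul_le_mul' (le_iSup₂ (f := fun s (_ : s ∈ Ioo (-1 : ℝ) 0) =>
        eLpNorm (w l s - u s) (q : ℝ≥0∞) μ) s hs) le_rfl
    have hlim' : Tendsto (fun l => (⨆ s ∈ Ioo (-1 : ℝ) 0, eLpNorm (w l s - u s) (q : ℝ≥0∞) μ) * C)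
        (𝓝[>] 0) (𝓝 0) := by
      have h := ENNReal.Tendsto.mul_const (hlim R hR0) (Or.inr hCtop)
      rw [zero_mul] at h
      simpa only [hw, hu, hμ, Pi.sub_def] using h
    exact tendsto_of_tendsto_of_tendsto_of_le_of_le' tendsto_const_nhds hlim'
      (Eventually.of_forall fun _ => zero_le) hle
  -- ### Step 3: a uniform `L²(B_R)` bound on the slices `u s`, `s ∈ [a', b]`
  obtain ⟨l₀, ⟨hl₀, hl₀T⟩, hD2l₀⟩ : ∃ l₀, (0 < l₀ ∧ l₀ ^ 2 ≤ T) ∧ D2 l₀ ≤ 1 :=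
    (hev.and (hD2lim.eventually (Iic_mem_nhds one_pos))).exists
  obtain ⟨N, hN⟩ : ∃ N, ∀ p ∈ Icc a' b ×ˢ closedBall (0 : EuclideanSpace ℝ (Fin 3)) R,
      ‖uncurry (w l₀) p‖ ≤ N :=
    (isCompact_Icc.prod (isCompact_closedBall 0 R)).exists_bound_of_continuousOn
      ((hwcont hl₀ hl₀T).mono (prod_mono hIcc (subset_univ _)))
  set M : ℝ≥0∞ := μ univ ^ (2 : ℝ≥0∞).toReal⁻¹ * ENNReal.ofReal N + 1 with hM
  have hMtop : M ≠ ∞ := by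
    rw [hM]
    exact ENNReal.add_ne_top.2 ⟨ENNReal.mul_ne_top
      (ENNReal.rpow_ne_top_of_nonneg (by positivity) (measure_ne_top μ _)) ENNReal.ofReal_ne_top,
      ENNReal.one_ne_top⟩
  have hm : ∀ s ∈ Icc a' b, eLpNorm (u s) 2 μ ≤ M := by
    intro s hs
    have hs' := hIcc hs
    have h1 : eLpNorm (w l₀ s) 2 μ ≤ μ univ ^ (2 : ℝ≥0∞).toReal⁻¹ * ENNReal.ofReal N := by
      refine eLpNorm_le_of_ae_bound ?_
      rw [hμ, ae_restrict_iff' measurableSet_ball]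
      exact Eventually.of_forall fun y hy => hN (s, y) ⟨hs, ball_subset_closedBall hy⟩
    have h2 : eLpNorm (w l₀ s - u s) 2 μ ≤ 1 :=
      le_trans (le_iSup₂ (f := fun s (_ : s ∈ Ioo (-1 : ℝ) 0) => eLpNorm (w l₀ s - u s) 2 μ) s hs')
        hD2l₀
    have hwm : AEStronglyMeasurable (w l₀ s) μ := (hwslice hl₀ hl₀T s hs').aestronglyMeasurable
    have hum : AEStronglyMeasurable (u s) μ := (hmeas_u s).restrict
    have heq : u s = w l₀ s - (w l₀ s - u s) := by simp
    calc eLpNorm (u s) 2 μ = eLpNorm (w l₀ s - (w l₀ s - u s)) 2 μ := by rw [← heq]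
      _ ≤ eLpNorm (w l₀ s) 2 μ + eLpNorm (w l₀ s - u s) 2 μ :=
          eLpNorm_sub_le hwm (hwm.sub hum) (by norm_num)
      _ ≤ _ := add_le_add h1 h2
  -- ### Step 4: the uniform estimate of the pairings
  set ρ : ℝ → ℝ≥0∞ := fun l => ENNReal.ofReal K * D2 l *
    (2 * μ univ ^ (1 / 2 : ℝ) + D2 l + 2 * M) with hρ
  have hρlim : Tendsto ρ (𝓝[>] 0) (𝓝 0) := by
    have h1 : Tendsto (fun l => ENNReal.ofReal K * D2 l) (𝓝[>] 0) (𝓝 0) := by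
      have h := ENNReal.Tendsto.const_mul (a := ENNReal.ofReal K) hD2lim (Or.inr ENNReal.ofReal_ne_top)
      rwa [mul_zero] at h
    have h2 : Tendsto (fun l => 2 * μ univ ^ (1 / 2 : ℝ) + D2 l + 2 * M) (𝓝[>] 0)
        (𝓝 (2 * μ univ ^ (1 / 2 : ℝ) + 0 + 2 * M)) :=
      (tendsto_const_nhds.add hD2lim).add tendsto_const_nhds
    have hfin : 2 * μ univ ^ (1 / 2 : ℝ) + 0 + 2 * M ≠ ∞ := by
      refine ENNReal.add_ne_top.2 ⟨ENNReal.add_ne_top.2 ⟨ENNReal.mul_ne_top (by norm_num)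
        (ENNReal.rpow_ne_top_of_nonneg (by norm_num) (measure_ne_top μ _)), ENNReal.zero_ne_top⟩,
        ENNReal.mul_ne_top (by norm_num) hMtop⟩
    have h3 : (2 * μ univ ^ (1 / 2 : ℝ) + 0 + 2 * M) ≠ 0 ∨ (0 : ℝ≥0∞) ≠ ∞ := Or.inr ENNReal.zero_ne_top
    have h := ENNReal.Tendsto.mul h1 (Or.inr hfin) h2 h3
    rwa [zero_mul] at h
  have happ : Continuous fun p : (EuclideanSpace ℝ (Fin 3) →L[ℝ] EuclideanSpace ℝ (Fin 3)) ×
      EuclideanSpace ℝ (Fin 3) => p.1 p.2 :=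
    (isBoundedBilinearMap_apply (𝕜 := ℝ) (E := EuclideanSpace ℝ (Fin 3))
      (F := EuclideanSpace ℝ (Fin 3))).continuous
  have hest : ∀ {l : ℝ}, 0 < l → l ^ 2 ≤ T → ∀ s, ‖F (w l) s - F u s‖ₑ ≤ ρ l := by
    intro l hl hlT s
    by_cases hs : s ∈ Icc a' b
    · have hs' := hIcc hs
      -- slice data: continuity and measurability
      have hφ1 : Continuous (timeDeriv ψ s) := hc1.uncurry_left s
      have hφ2 : Continuous fun y => fderiv ℝ (ψ s) y := hc2.uncurry_left s
      have hφ3 : Continuous fun y => Δ (ψ s) y := hc3.uncurry_left s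
      have hws : Continuous (w l s) := hwslice hl hlT s hs'
      have hwm : AEStronglyMeasurable (w l s) μ := hws.aestronglyMeasurable
      have hum : AEStronglyMeasurable (u s) μ := (hmeas_u s).restrict
      -- integrability of the slice integrand of the rescaling (continuous on the closed ball)
      have hfi : Integrable (fun y => ⟪w l s y, timeDeriv ψ s y⟫ +
          ⟪w l s y, fderiv ℝ (ψ s) y (w l s y)⟫ + ⟪w l s y, Δ (ψ s) y⟫) μ := by
        have hcont : Continuous fun y => ⟪w l s y, timeDeriv ψ s y⟫ +
            ⟪w l s y, fderiv ℝ (ψ s) y (w l s y)⟫ + ⟪w l s y, Δ (ψ s) y⟫ :=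
          ((hws.inner hφ1).add (hws.inner (happ.comp (hφ2.prodMk hws)))).add (hws.inner hφ3)
        rw [hμ]
        exact (hcont.continuousOn.integrableOn_compact (isCompact_closedBall 0 R)).mono_set
          ball_subset_closedBall
      -- integrability of the slice integrand of the limit (`u s ∈ L²(B_R)`)
      have hu2 : MemLp (u s) 2 μ := ⟨hum, (hm s hs).trans_lt hMtop.lt_top⟩
      have hgi : Integrable (fun y => ⟪u s y, timeDeriv ψ s y⟫ +
          ⟪u s y, fderiv ℝ (ψ s) y (u s y)⟫ + ⟪u s y, Δ (ψ s) y⟫) μ := by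
        have hmeas : AEStronglyMeasurable (fun y => ⟪u s y, timeDeriv ψ s y⟫ +
            ⟪u s y, fderiv ℝ (ψ s) y (u s y)⟫ + ⟪u s y, Δ (ψ s) y⟫) μ :=
          ((hum.inner hφ1.aestronglyMeasurable).add (hum.inner
            (happ.comp_aestronglyMeasurable (hφ2.aestronglyMeasurable.prodMk hum)))).add
            (hum.inner hφ3.aestronglyMeasurable)
        have hint1 : Integrable (fun y => ‖u s y‖) μ := (hu2.integrable one_le_two).norm
        have hint2 : Integrable (fun y => ‖u s y‖ ^ 2) μ :=
          (memLp_two_iff_integrable_sq_norm hum).1 hu2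
        refine Integrable.mono' (((hint1.const_mul K).add (hint2.const_mul K)).add
          (hint1.const_mul K)) hmeas (Eventually.of_forall fun y => ?_)
        have e1 : |⟪u s y, timeDeriv ψ s y⟫| ≤ K * ‖u s y‖ := by
          rw [mul_comm]
          exact (abs_real_inner_le_norm _ _).trans
            (mul_le_mul_of_nonneg_left (hKa s y) (norm_nonneg _))
        have e2 : |⟪u s y, fderiv ℝ (ψ s) y (u s y)⟫| ≤ K * ‖u s y‖ ^ 2 := by
          calc |⟪u s y, fderiv ℝ (ψ s) y (u s y)⟫| ≤ ‖u s y‖ * ‖fderiv ℝ (ψ s) y (u s y)‖ :=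
                abs_real_inner_le_norm _ _
            _ ≤ ‖u s y‖ * (‖fderiv ℝ (ψ s) y‖ * ‖u s y‖) := by
                gcongr; exact ContinuousLinearMap.le_opNorm _ _
            _ ≤ ‖u s y‖ * (K * ‖u s y‖) := by gcongr; exact hKB s y
            _ = K * ‖u s y‖ ^ 2 := by ring
        have e3 : |⟪u s y, Δ (ψ s) y⟫| ≤ K * ‖u s y‖ := by
          rw [mul_comm]
          exact (abs_real_inner_le_norm _ _).trans
            (mul_le_mul_of_nonneg_left (hKc s y) (norm_nonneg _))
        rw [Real.norm_eq_abs]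
        simp only [Pi.add_apply]
        exact (abs_add_le _ _).trans (add_le_add ((abs_add_le _ _).trans (add_le_add e1 e2)) e3)
      -- the slice estimate
      have key := enorm_integral_weakIntegrand_sub_le μ hwm hum hφ1.aestronglyMeasurable
        hφ2.aestronglyMeasurable hφ3.aestronglyMeasurable (hKa s) (hKB s) (hKc s) hfi hgi
      rw [hFμ, hFμ]
      simp only [hΦ, convect_apply]
      refine key.trans ?_
      have he : eLpNorm (w l s - u s) 2 μ ≤ D2 l :=
        le_iSup₂ (f := fun s (_ : s ∈ Ioo (-1 : ℝ) 0) => eLpNorm (w l s - u s) 2 μ) s hs'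
      have hm' := hm s hs
      simp only [hρ]
      gcongr
    · rw [hFzero (w l) s hs, hFzero u s hs, sub_zero, enorm_zero]
      exact zero_le
  -- ### Step 5: the pairings converge uniformly; the limit pairing is continuous
  have hunif : TendstoUniformly (fun l => F (w l)) (F u) (𝓝[>] 0) := by
    rw [Metric.tendstoUniformly_iff]
    intro ε hε
    have hρε : ∀ᶠ l in 𝓝[>] (0 : ℝ), ρ l < ENNReal.ofReal ε :=
      hρlim.eventually (Iio_mem_nhds (ENNReal.ofReal_pos.2 hε))
    filter_upwards [hev, hρε] with l hl hlε s
    rw [dist_comm, Real.dist_eq]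
    have hfin : ρ l ≠ ∞ := (hlε.trans ENNReal.ofReal_lt_top).ne
    calc |F (w l) s - F u s| = ‖F (w l) s - F u s‖ₑ.toReal := by
          rw [toReal_enorm, Real.norm_eq_abs]
      _ ≤ (ρ l).toReal := ENNReal.toReal_mono hfin (hest hl.1 hl.2 s)
      _ < ε := ENNReal.toReal_lt_of_lt_ofReal hlε
  have hcont : Continuous (F u) :=
    hunif.continuous (hev.mono fun l hl => hFwcont hl.1 hl.2).frequently
  refine ⟨hcont, ?_⟩
  -- ### Step 6: the time integrals converge, and those of the rescalings vanish
  have hIu : IntegrableOn (F u) (Ioo (-1 : ℝ) 0) volume :=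
    (hcont.integrableOn_Icc (a := -1) (b := 0)).mono_set Ioo_subset_Icc_self
  have hρreal : Tendsto (fun l => (ρ l).toReal) (𝓝[>] 0) (𝓝 0) := by
    have := (ENNReal.tendsto_toReal ENNReal.zero_ne_top).comp hρlim
    simpa [Function.comp_def] using this
  have hρ1 : ∀ᶠ l in 𝓝[>] (0 : ℝ), ρ l < 1 := hρlim.eventually (Iio_mem_nhds one_pos)
  have htend : Tendsto (fun l => ∫ s in Ioo (-1 : ℝ) 0, F (w l) s) (𝓝[>] 0)
      (𝓝 (∫ s in Ioo (-1 : ℝ) 0, F u s)) := by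
    rw [tendsto_iff_norm_sub_tendsto_zero]
    refine squeeze_zero' (Eventually.of_forall fun _ => norm_nonneg _) ?_ hρreal
    filter_upwards [hev, hρ1] with l hl hl1
    have hfin : ρ l ≠ ∞ := (hl1.trans ENNReal.one_lt_top).ne
    have hIw : IntegrableOn (F (w l)) (Ioo (-1 : ℝ) 0) volume :=
      ((hFwcont hl.1 hl.2).integrableOn_Icc (a := -1) (b := 0)).mono_set Ioo_subset_Icc_self
    have hpt : ∀ s, ‖F (w l) s - F u s‖ ≤ (ρ l).toReal := fun s => by
      have := ENNReal.toReal_mono hfin (hest hl.1 hl.2 s)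
      rwa [toReal_enorm] at this
    rw [← integral_sub hIw hIu]
    calc ‖∫ s in Ioo (-1 : ℝ) 0, (F (w l) s - F u s)‖
        ≤ ∫ s in Ioo (-1 : ℝ) 0, ‖F (w l) s - F u s‖ := norm_integral_le_integral_norm _
      _ ≤ ∫ _ in Ioo (-1 : ℝ) 0, (ρ l).toReal := by
          refine setIntegral_mono_on (hIw.sub hIu).norm (integrableOn_const ?_) measurableSet_Ioo
            fun s _ => hpt s
          simp
      _ = (ρ l).toReal := by
          rw [setIntegral_const]
          simp [Measure.real, Real.volume_Ioo]
  have h0 : ∀ᶠ l in 𝓝[>] (0 : ℝ), ∫ s in Ioo (-1 : ℝ) 0, F (w l) s = 0 :=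
    hev.mono fun l hl => hFw0 hl.1 hl.2
  exact tendsto_nhds_unique htend (tendsto_const_nhds.congr' (h0.mono fun l h => h.symm))

end Core



section DivFree

variable {T : ℝ} {z : EuclideanSpace ℝ (Fin 3)} {q : ℝ≥0}
  {v : ℝ → EuclideanSpace ℝ (Fin 3) → EuclideanSpace ℝ (Fin 3)}
  {π : ℝ → EuclideanSpace ℝ (Fin 3) → ℝ}
  {V : EuclideanSpace ℝ (Fin 3) → EuclideanSpace ℝ (Fin 3)}

/-- **The limit profile is locally `L^q`**: under the convergence hypothesis, every slice
`u_V(s)`, `s ∈ (−1, 0)`, of the backward self-similar field lies in `L^q(B(0, R))` for every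
`R > 0` (the rescalings `v_λ(s)` are smooth, hence in `L^q(B_R)`, and some `v_λ(s) − u_V(s)` has
finite `L^q(B_R)` norm). [cite: Chae2007, proof of Thm 1.5 (arXiv p. 8)] -/
theorem memLp_lerayBackward_restrict_ball (hT : 0 < T)
    (hv : IsClassicalNSSolutionOn (Ioo 0 T) 1 0 v π)
    (hq : 2 ≤ q) (hV : AEStronglyMeasurable V volume)
    (hlim : ∀ R : ℝ, 0 < R → Tendsto (fun l : ℝ => ⨆ s ∈ Ioo (-1 : ℝ) 0, eLpNorm
        (fun y => nsRescale l (fun τ x => v (T + τ) (z + x)) s y - lerayBackward (1 / 2) 0 V s y)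
        (q : ℝ≥0∞) (volume.restrict (ball 0 R))) (𝓝[>] 0) (𝓝 0))
    {s : ℝ} (hs : s ∈ Ioo (-1 : ℝ) 0) {R : ℝ} (hR : 0 < R) :
    MemLp (lerayBackward (1 / 2) 0 V s) (q : ℝ≥0∞) (volume.restrict (ball 0 R)) := by
  have hq1 : (1 : ℝ≥0∞) ≤ (q : ℝ≥0∞) := by
    have : (1 : ℝ≥0) ≤ q := le_trans (by norm_num) hq
    exact_mod_cast this
  set w : ℝ → ℝ → EuclideanSpace ℝ (Fin 3) → EuclideanSpace ℝ (Fin 3) :=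
    fun l => nsRescale l (fun τ x => v (T + τ) (z + x)) with hw
  set u : ℝ → EuclideanSpace ℝ (Fin 3) → EuclideanSpace ℝ (Fin 3) := lerayBackward (1 / 2) 0 V
    with hu
  set μ : Measure (EuclideanSpace ℝ (Fin 3)) := volume.restrict (ball 0 R) with hμ
  haveI hμfin : IsFiniteMeasure μ := by
    rw [hμ]; exact isFiniteMeasure_restrict.2 measure_ball_lt_top.ne
  -- a parameter `l₀` with `l₀² ≤ T` and deviation at most one
  have hev : ∀ᶠ l in 𝓝[>] (0 : ℝ), 0 < l ∧ l ^ 2 ≤ T := by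
    have h1 : ∀ᶠ l in 𝓝[>] (0 : ℝ), 0 < l := self_mem_nhdsWithin
    have h2 : ∀ᶠ l in 𝓝 (0 : ℝ), l ^ 2 ≤ T := by
      have ht : Tendsto (fun l : ℝ => l ^ 2) (𝓝 0) (𝓝 0) := by
        simpa using ((continuous_pow 2).tendsto (0 : ℝ))
      exact (ht.eventually (Iic_mem_nhds hT))
    exact h1.and (mem_nhdsWithin_of_mem_nhds h2)
  obtain ⟨l₀, ⟨hl₀, hl₀T⟩, hD⟩ : ∃ l₀, (0 < l₀ ∧ l₀ ^ 2 ≤ T) ∧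
      (⨆ s ∈ Ioo (-1 : ℝ) 0, eLpNorm (w l₀ s - u s) (q : ℝ≥0∞) μ) ≤ 1 := by
    have h := (hev.and ((hlim R hR).eventually (Iic_mem_nhds one_pos))).exists
    simpa only [hw, hu, hμ, Pi.sub_def] using h
  have hsl : s ∈ Ioo (-(T / l₀ ^ 2)) 0 := by
    refine ⟨lt_of_le_of_lt ?_ hs.1, hs.2⟩
    rw [neg_le_neg_iff, le_div_iff₀ (by positivity)]
    linarith
  have hws : Continuous (w l₀ s) :=
    ((isClassicalNSSolutionOn_nsRescale_translate (z := z) hv hl₀).contDiff_velocity hsl).continuous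
  have hwm : AEStronglyMeasurable (w l₀ s) μ := hws.aestronglyMeasurable
  have hum : AEStronglyMeasurable (u s) μ := (aestronglyMeasurable_lerayBackward hV (1 / 2) 0 s).restrict
  -- `w l₀ s` is bounded on the closed ball
  obtain ⟨N, hN⟩ : ∃ N, ∀ y ∈ closedBall (0 : EuclideanSpace ℝ (Fin 3)) R, ‖w l₀ s y‖ ≤ N :=
    (isCompact_closedBall 0 R).exists_bound_of_continuousOn hws.continuousOn
  have h1 : eLpNorm (w l₀ s) (q : ℝ≥0∞) μ < ∞ := by
    refine (eLpNorm_le_of_ae_bound (C := N) ?_).trans_lt ?_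
    · rw [hμ, ae_restrict_iff' measurableSet_ball]
      exact Eventually.of_forall fun y hy => hN y (ball_subset_closedBall hy)
    · exact ENNReal.mul_lt_top ((ENNReal.rpow_lt_top_of_nonneg (by positivity)
        (measure_ne_top μ _))) ENNReal.ofReal_lt_top
  have h2 : eLpNorm (w l₀ s - u s) (q : ℝ≥0∞) μ ≤ 1 :=
    le_trans (le_iSup₂ (f := fun s (_ : s ∈ Ioo (-1 : ℝ) 0) =>
      eLpNorm (w l₀ s - u s) (q : ℝ≥0∞) μ) s hs) hD
  refine ⟨hum, ?_⟩
  have heq : u s = w l₀ s - (w l₀ s - u s) := by simp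
  calc eLpNorm (u s) (q : ℝ≥0∞) μ = eLpNorm (w l₀ s - (w l₀ s - u s)) (q : ℝ≥0∞) μ := by
        rw [← heq]
    _ ≤ eLpNorm (w l₀ s) (q : ℝ≥0∞) μ + eLpNorm (w l₀ s - u s) (q : ℝ≥0∞) μ :=
        eLpNorm_sub_le hwm (hwm.sub hum) hq1
    _ < ∞ := ENNReal.add_lt_top.2 ⟨h1, h2.trans_lt ENNReal.one_lt_top⟩

end DivFree



section DivFreeProfile

variable {T : ℝ} {z : EuclideanSpace ℝ (Fin 3)} {q : ℝ≥0}
  {v : ℝ → EuclideanSpace ℝ (Fin 3) → EuclideanSpace ℝ (Fin 3)}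
  {π : ℝ → EuclideanSpace ℝ (Fin 3) → ℝ}
  {V : EuclideanSpace ℝ (Fin 3) → EuclideanSpace ℝ (Fin 3)}

/-- The slice of Chae's comparison field at `s = -1/4` is the dilated profile `y ↦ 2 V(2y)`
(`√(2·½·¼) = ½`). [folklore] -/
theorem lerayBackward_half_neg_quarter (V : EuclideanSpace ℝ (Fin 3) → EuclideanSpace ℝ (Fin 3)) :
    lerayBackward (1 / 2) 0 V (-1 / 4) = fun y => (2 : ℝ) • V ((2 : ℝ) • y) := by
  funext y
  have h : Real.sqrt (2 * (1 / 2) * (0 - -1 / 4)) = 2⁻¹ := by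
    rw [show (2 * (1 / 2) * (0 - -1 / 4) : ℝ) = (2⁻¹) ^ 2 by norm_num,
      Real.sqrt_sq (by norm_num)]
  rw [lerayBackward_apply, h, inv_inv]

/-- **Weak divergence-freeness passes to the blow-up limit**: under the convergence hypothesis,
every slice `u_V(s)`, `s ∈ (−1, 0)`, of the limit field is weakly divergence free (the
rescalings are classically divergence free, and `∫⟪v_λ(s) − u_V(s), ∇θ⟫ → 0` by Cauchy–Schwarz
on a ball containing `supp θ`). [cite: Chae2007, proof of Thm 1.5 (arXiv p. 8)] -/
theorem isWeaklyDivFree_lerayBackward_of_tendsto (hT : 0 < T)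
    (hv : IsClassicalNSSolutionOn (Ioo 0 T) 1 0 v π) (hq : 2 ≤ q)
    (hV : AEStronglyMeasurable V volume)
    (hlim : ∀ R : ℝ, 0 < R → Tendsto (fun l : ℝ => ⨆ s ∈ Ioo (-1 : ℝ) 0, eLpNorm
        (fun y => nsRescale l (fun τ x => v (T + τ) (z + x)) s y - lerayBackward (1 / 2) 0 V s y)
        (q : ℝ≥0∞) (volume.restrict (ball 0 R))) (𝓝[>] 0) (𝓝 0))
    {s : ℝ} (hs : s ∈ Ioo (-1 : ℝ) 0) :
    IsWeaklyDivFree (lerayBackward (1 / 2) 0 V s) := by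
  intro θ hθ
  set w : ℝ → ℝ → EuclideanSpace ℝ (Fin 3) → EuclideanSpace ℝ (Fin 3) :=
    fun l => nsRescale l (fun τ x => v (T + τ) (z + x)) with hw
  set u : ℝ → EuclideanSpace ℝ (Fin 3) → EuclideanSpace ℝ (Fin 3) := lerayBackward (1 / 2) 0 V
    with hu
  change ∫ x, ⟪u s x, gradient θ x⟫ = 0
  -- the support of `θ` and the measure on the ball
  obtain ⟨R, hR0, hR⟩ : ∃ R, 0 < R ∧ tsupport θ ⊆ ball (0 : EuclideanSpace ℝ (Fin 3)) R :=
    hθ.hasCompactSupport.isBounded.subset_ball_lt 0 0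
  set μ : Measure (EuclideanSpace ℝ (Fin 3)) := volume.restrict (ball 0 R) with hμ
  haveI hμfin : IsFiniteMeasure μ := by
    rw [hμ]; exact isFiniteMeasure_restrict.2 measure_ball_lt_top.ne
  have hθ1 : ContDiff ℝ 1 θ := contDiff_infty.1 hθ.contDiff 1
  have hgc : Continuous (gradient θ) := continuous_gradient_of_contDiff hθ1
  have hgzero : ∀ x, x ∉ ball (0 : EuclideanSpace ℝ (Fin 3)) R → gradient θ x = 0 := by
    intro x hx
    have hx' : x ∉ tsupport θ := fun h => hx (hR h)
    have h0 : θ =ᶠ[𝓝 x] fun _ => 0 := notMem_tsupport_iff_eventuallyEq.1 hx'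
    rw [gradient, h0.fderiv_eq, fderiv_const_apply, map_zero]
  have hint_eq : ∀ f : EuclideanSpace ℝ (Fin 3) → EuclideanSpace ℝ (Fin 3),
      ∫ x, ⟪f x, gradient θ x⟫ = ∫ x, ⟪f x, gradient θ x⟫ ∂μ := by
    intro f
    rw [hμ, setIntegral_eq_integral_of_forall_compl_eq_zero]
    intro x hx
    rw [hgzero x hx, inner_zero_right]
  have hgcs : HasCompactSupport (gradient θ) := by
    have : gradient θ = (fun L => (InnerProductSpace.toDual ℝ (EuclideanSpace ℝ (Fin 3))).symm L) ∘
        fderiv ℝ θ := rfl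
    rw [this]
    exact (hθ.hasCompactSupport.fderiv (𝕜 := ℝ)).comp_left (by simp)
  obtain ⟨Kθ, hKθ⟩ : ∃ Kθ, ∀ x, ‖gradient θ x‖ ≤ Kθ := hgc.bounded_above_of_compact_support hgcs
  have hG : eLpNorm (gradient θ) 2 μ < ∞ :=
    (eLpNorm_le_of_ae_bound (Eventually.of_forall hKθ)).trans_lt (ENNReal.mul_lt_top
      (ENNReal.rpow_lt_top_of_nonneg (by positivity) (measure_ne_top μ _)) ENNReal.ofReal_lt_top)
  -- small parameters: the rescalings are classical on a slab containing `s`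
  have hev : ∀ᶠ l in 𝓝[>] (0 : ℝ), 0 < l ∧ l ^ 2 ≤ T := by
    have h1 : ∀ᶠ l in 𝓝[>] (0 : ℝ), 0 < l := self_mem_nhdsWithin
    have h2 : ∀ᶠ l in 𝓝 (0 : ℝ), l ^ 2 ≤ T := by
      have ht : Tendsto (fun l : ℝ => l ^ 2) (𝓝 0) (𝓝 0) := by
        simpa using ((continuous_pow 2).tendsto (0 : ℝ))
      exact (ht.eventually (Iic_mem_nhds hT))
    exact h1.and (mem_nhdsWithin_of_mem_nhds h2)
  have hsl : ∀ {l : ℝ}, 0 < l → l ^ 2 ≤ T → s ∈ Ioo (-(T / l ^ 2)) 0 := by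
    intro l hl hlT
    refine ⟨lt_of_le_of_lt ?_ hs.1, hs.2⟩
    rw [neg_le_neg_iff, le_div_iff₀ (by positivity)]
    linarith
  have hwcl : ∀ {l : ℝ}, 0 < l →
      IsClassicalNSSolutionOn (Ioo (-(T / l ^ 2)) 0) 1 0 (w l)
        (fun s y => l ^ 2 * π (T + l ^ 2 * s) (z + l • y)) := fun hl =>
    isClassicalNSSolutionOn_nsRescale_translate hv hl
  have hws : ∀ {l : ℝ}, 0 < l → l ^ 2 ≤ T → Continuous (w l s) := fun hl hlT =>
    ((hwcl hl).contDiff_velocity (hsl hl hlT)).continuous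
  -- the rescalings are weakly divergence free
  have hzero : ∀ᶠ l in 𝓝[>] (0 : ℝ), ∫ x, ⟪w l s x, gradient θ x⟫ ∂μ = 0 := by
    filter_upwards [hev] with l hl
    rw [← hint_eq]
    exact VectorCalculus.IsDivFree.isWeaklyDivFree_holds ((hwcl hl.1).divFree s (hsl hl.1 hl.2))
      (contDiff_infty.1 ((hwcl hl.1).contDiff_velocity (hsl hl.1 hl.2)) 1) θ hθ
  -- the `L²(B_R)` deviation at the slice `s` tends to zero
  have hum : AEStronglyMeasurable (u s) μ := (aestronglyMeasurable_lerayBackward hV (1 / 2) 0 s).restrict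
  have he : Tendsto (fun l => eLpNorm (w l s - u s) 2 μ) (𝓝[>] 0) (𝓝 0) := by
    set C : ℝ≥0∞ := μ univ ^ (1 / (2 : ℝ≥0∞).toReal - 1 / ((q : ℝ≥0∞)).toReal) with hC
    have hCtop : C ≠ ∞ := by
      rw [hC]
      refine ENNReal.rpow_ne_top_of_nonneg ?_ (measure_ne_top μ _)
      have hq' : (2 : ℝ) ≤ (q : ℝ) := by exact_mod_cast hq
      have hqpos : (0 : ℝ) < q := by linarith
      simp only [ENNReal.toReal_ofNat, ENNReal.coe_toReal, sub_nonneg]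
      rw [one_div_le_one_div hqpos (by norm_num)]
      exact hq'
    have hle : ∀ᶠ l in 𝓝[>] (0 : ℝ), eLpNorm (w l s - u s) 2 μ ≤ (⨆ s ∈ Ioo (-1 : ℝ) 0,
        eLpNorm (w l s - u s) (q : ℝ≥0∞) μ) * C := by
      filter_upwards [hev] with l hl
      have hq2 : (2 : ℝ≥0∞) ≤ (q : ℝ≥0∞) := by exact_mod_cast hq
      refine (eLpNorm_le_eLpNorm_mul_rpow_measure_univ hq2
        (((hws hl.1 hl.2).aestronglyMeasurable.sub hum))).trans ?_
      exact mul_le_mul' (le_iSup₂ (f := fun s (_ : s ∈ Ioo (-1 : ℝ) 0) =>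
        eLpNorm (w l s - u s) (q : ℝ≥0∞) μ) s hs) le_rfl
    have hlim' : Tendsto (fun l => (⨆ s ∈ Ioo (-1 : ℝ) 0, eLpNorm (w l s - u s) (q : ℝ≥0∞) μ) * C)
        (𝓝[>] 0) (𝓝 0) := by
      have h := ENNReal.Tendsto.mul_const (hlim R hR0) (Or.inr hCtop)
      rw [zero_mul] at h
      simpa only [hw, hu, hμ, Pi.sub_def] using h
    exact tendsto_of_tendsto_of_tendsto_of_le_of_le' tendsto_const_nhds hlim'
      (Eventually.of_forall fun _ => zero_le) hle
  -- integrability of the two pairings on the ball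
  have hu2 : MemLp (u s) 2 μ :=
    (memLp_lerayBackward_restrict_ball hT hv hq hV hlim hs hR0).mono_exponent
      (by exact_mod_cast hq)
  have hui : Integrable (fun x => ⟪u s x, gradient θ x⟫) μ := by
    refine Integrable.mono' ((hu2.integrable one_le_two).norm.mul_const Kθ)
      (hum.inner hgc.aestronglyMeasurable) (Eventually.of_forall fun x => ?_)
    rw [Real.norm_eq_abs]
    exact (abs_real_inner_le_norm _ _).trans (mul_le_mul_of_nonneg_left (hKθ x) (norm_nonneg _))
  have hwi : ∀ {l : ℝ}, 0 < l → l ^ 2 ≤ T → Integrable (fun x => ⟪w l s x, gradient θ x⟫) μ := by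
    intro l hl hlT
    rw [hμ]
    exact (((hws hl hlT).inner hgc).continuousOn.integrableOn_compact
      (isCompact_closedBall 0 R)).mono_set ball_subset_closedBall
  -- convergence of the pairings
  have htend : Tendsto (fun l => ∫ x, ⟪w l s x, gradient θ x⟫ ∂μ) (𝓝[>] 0)
      (𝓝 (∫ x, ⟪u s x, gradient θ x⟫ ∂μ)) := by
    rw [tendsto_iff_norm_sub_tendsto_zero]
    have hbound : ∀ᶠ l in 𝓝[>] (0 : ℝ), ‖(∫ x, ⟪w l s x, gradient θ x⟫ ∂μ) -
        ∫ x, ⟪u s x, gradient θ x⟫ ∂μ‖ ≤ (eLpNorm (w l s - u s) 2 μ * eLpNorm (gradient θ) 2 μ).toReal := by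
      have he1 : ∀ᶠ l in 𝓝[>] (0 : ℝ), eLpNorm (w l s - u s) 2 μ < 1 := he.eventually (Iio_mem_nhds one_pos)
      filter_upwards [hev, he1] with l hl hl1
      have hwm : AEStronglyMeasurable (w l s) μ := (hws hl.1 hl.2).aestronglyMeasurable
      have hfin : eLpNorm (w l s - u s) 2 μ * eLpNorm (gradient θ) 2 μ ≠ ∞ :=
        ENNReal.mul_ne_top (hl1.trans ENNReal.one_lt_top).ne hG.ne
      have key : ‖(∫ x, ⟪w l s x, gradient θ x⟫ ∂μ) - ∫ x, ⟪u s x, gradient θ x⟫ ∂μ‖ₑ ≤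
          eLpNorm (w l s - u s) 2 μ * eLpNorm (gradient θ) 2 μ := by
        rw [← integral_sub (hwi hl.1 hl.2) hui]
        refine (enorm_integral_le_lintegral_enorm _).trans ?_
        have hpt : ∀ x, ⟪w l s x, gradient θ x⟫ - ⟪u s x, gradient θ x⟫ =
            ⟪(w l s - u s) x, gradient θ x⟫ := fun x => by
          rw [Pi.sub_apply, inner_sub_left]
        simp_rw [hpt]
        exact lintegral_enorm_inner_le_eLpNorm_two_mul μ (hwm.sub hum) hgc.aestronglyMeasurable
      have := ENNReal.toReal_mono hfin key
      rwa [toReal_enorm] at this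
    have hlim0 : Tendsto (fun l => (eLpNorm (w l s - u s) 2 μ * eLpNorm (gradient θ) 2 μ).toReal)
        (𝓝[>] 0) (𝓝 0) := by
      have h1 : Tendsto (fun l => eLpNorm (w l s - u s) 2 μ * eLpNorm (gradient θ) 2 μ)
          (𝓝[>] 0) (𝓝 0) := by
        have h := ENNReal.Tendsto.mul_const he (Or.inr hG.ne)
        rwa [zero_mul] at h
      have := (ENNReal.tendsto_toReal ENNReal.zero_ne_top).comp h1
      simpa [Function.comp_def] using this
    exact squeeze_zero' (Eventually.of_forall fun _ => norm_nonneg _) hbound hlim0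
  have hlim_eq : ∫ x, ⟪u s x, gradient θ x⟫ ∂μ = 0 :=
    tendsto_nhds_unique htend (tendsto_const_nhds.congr' (hzero.mono fun l h => h.symm))
  rw [hint_eq, hlim_eq]

/-- **The profile is weakly divergence free** (Chae 2007, proof of Thm 1.5, arXiv p. 8:
`V̄` "is a weak solution of the Leray system", whose second equation is `div V̄ = 0`): under
the convergence hypothesis, `∫⟪V̄, ∇θ⟫ = 0` for every test function `θ`. (The slice of the limit
field at `s = -1/4` is `y ↦ 2V̄(2y)`, and weak divergence-freeness is scale invariant,
`IsWeaklyDivFree.nsRescaleData`.) [cite: Chae2007, proof of Thm 1.5 (arXiv p. 8)] -/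
theorem isWeaklyDivFree_profile_of_tendsto (hT : 0 < T)
    (hv : IsClassicalNSSolutionOn (Ioo 0 T) 1 0 v π) (hq : 2 ≤ q)
    (hV : AEStronglyMeasurable V volume)
    (hlim : ∀ R : ℝ, 0 < R → Tendsto (fun l : ℝ => ⨆ s ∈ Ioo (-1 : ℝ) 0, eLpNorm
        (fun y => nsRescale l (fun τ x => v (T + τ) (z + x)) s y - lerayBackward (1 / 2) 0 V s y)
        (q : ℝ≥0∞) (volume.restrict (ball 0 R))) (𝓝[>] 0) (𝓝 0)) :
    IsWeaklyDivFree V := by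
  have h := isWeaklyDivFree_lerayBackward_of_tendsto hT hv hq hV hlim (s := -1 / 4)
    ⟨by norm_num, by norm_num⟩
  rw [lerayBackward_half_neg_quarter] at h
  have h2 := h.nsRescaleData (c := 2⁻¹) (by norm_num)
  have heq : nsRescaleData 2⁻¹ (fun y => (2 : ℝ) • V ((2 : ℝ) • y)) = V := by
    funext y
    simp [nsRescaleData, smul_smul]
  rwa [heq] at h2

/-- **The profile is locally `L^q`**: under the convergence hypothesis, `V̄ ∈ L^q(B(0, ρ))` for
every `ρ > 0` (from `memLp_lerayBackward_restrict_ball` at `s = -1/4` and the change of variables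
`y = 2x`, `eLpNorm_comp_add_smul_restrict_ball`). In particular the hypothesis of Chae's
Theorem 1.5 forces `V̄ ∈ L^q_{loc}` even when `q > p`. [cite: Chae2007, proof of Thm 1.5 (arXiv p. 8)] -/
theorem memLp_profile_restrict_ball_of_tendsto (hT : 0 < T)
    (hv : IsClassicalNSSolutionOn (Ioo 0 T) 1 0 v π) (hq : 2 ≤ q)
    (hV : AEStronglyMeasurable V volume)
    (hlim : ∀ R : ℝ, 0 < R → Tendsto (fun l : ℝ => ⨆ s ∈ Ioo (-1 : ℝ) 0, eLpNorm
        (fun y => nsRescale l (fun τ x => v (T + τ) (z + x)) s y - lerayBackward (1 / 2) 0 V s y)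
        (q : ℝ≥0∞) (volume.restrict (ball 0 R))) (𝓝[>] 0) (𝓝 0))
    {ρ : ℝ} (hρ : 0 < ρ) : MemLp V (q : ℝ≥0∞) (volume.restrict (ball 0 ρ)) := by
  have h := memLp_lerayBackward_restrict_ball hT hv hq hV hlim (s := -1 / 4) (R := ρ / 2)
    ⟨by norm_num, by norm_num⟩ (by positivity)
  rw [lerayBackward_half_neg_quarter] at h
  refine ⟨hV.restrict, ?_⟩
  have h1 : eLpNorm (fun y => (2 : ℝ) • V ((2 : ℝ) • y)) (q : ℝ≥0∞) (volume.restrict (ball 0 (ρ / 2))) =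
      ‖(2 : ℝ)‖ₑ * eLpNorm (fun y => V ((0 : EuclideanSpace ℝ (Fin 3)) + (2 : ℝ) • y)) (q : ℝ≥0∞)
        (volume.restrict (ball 0 (ρ / 2))) := by
    rw [← eLpNorm_const_smul]
    simp only [zero_add]
    rfl
  have h2 := eLpNorm_comp_add_smul_restrict_ball V 0 (l := 2) two_pos (ρ / 2) (p := (q : ℝ≥0∞))
    ENNReal.coe_ne_top
  rw [show (2 : ℝ) * (ρ / 2) = ρ by ring] at h2
  have hfin : ‖(2 : ℝ)‖ₑ * (ENNReal.ofReal (((2 : ℝ) ^ 3)⁻¹) ^ (1 / (q : ℝ≥0∞)).toReal *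
      eLpNorm V (q : ℝ≥0∞) (volume.restrict (ball 0 ρ))) < ∞ := by
    rw [← h2, ← h1]
    exact h.2
  have hc : ENNReal.ofReal (((2 : ℝ) ^ 3)⁻¹) ^ (1 / (q : ℝ≥0∞)).toReal ≠ 0 := by
    refine (ENNReal.rpow_pos (ENNReal.ofReal_pos.2 (by norm_num)) ENNReal.ofReal_ne_top).ne'
  have h2ne : ‖(2 : ℝ)‖ₑ ≠ 0 := by simp
  by_contra hcon
  rw [not_lt, top_le_iff] at hcon
  rw [hcon, ENNReal.mul_top hc, ENNReal.mul_top h2ne] at hfin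
  exact lt_irrefl _ hfin

end DivFreeProfile




section SelfSimilarTest

/-! ### Self-similar test fields `ψ(s, y) = θ(s) (−s)⁻¹ Φ(y/√(−s))`

Written with the tree's scale factor `c(s) = (√(2·½·(0 − s)))⁻¹ = (−s)^{-1/2}` of
`lerayBackward ½ 0` as `ψ s y = (θ s * c s) • lerayBackward ½ 0 Φ s y`. -/

/-- The scale factor of `lerayBackward ½ 0` at `s < 0` squared is `(−s)⁻¹`. [folklore] -/
theorem lerayScale_half_sq {s : ℝ} (hs : s < 0) :
    ((Real.sqrt (2 * (1 / 2) * (0 - s)))⁻¹) ^ 2 = (-s)⁻¹ := by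
  rw [lerayScale_sq (by norm_num : (0 : ℝ) < 1 / 2) hs]
  norm_num

/-- **Slice derivative of the self-similar test field**: for `s < 0`,
`D(ψ s)(y) = (θ(s) c(s)³) • DΦ(c(s) y)`. [folklore] -/
theorem fderiv_selfSimilarTest (θ : ℝ → ℝ)
    (Φ : EuclideanSpace ℝ (Fin 3) → EuclideanSpace ℝ (Fin 3)) (s : ℝ) (y : EuclideanSpace ℝ (Fin 3)) :
    fderiv ℝ (fun y => (θ s * (Real.sqrt (2 * (1 / 2) * (0 - s)))⁻¹) •
        lerayBackward (1 / 2) 0 Φ s y) y =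
      (θ s * ((Real.sqrt (2 * (1 / 2) * (0 - s)))⁻¹) ^ 3) •
        fderiv ℝ Φ ((Real.sqrt (2 * (1 / 2) * (0 - s)))⁻¹ • y) := by
  set c : ℝ := (Real.sqrt (2 * (1 / 2) * (0 - s)))⁻¹ with hc
  have h : (fun y => (θ s * c) • lerayBackward (1 / 2) 0 Φ s y) =
      (θ s * c) • lerayBackward (1 / 2) 0 Φ s := rfl
  rw [h, fderiv_const_smul_field, Pi.smul_apply, fderiv_lerayBackward, smul_smul, ← hc]
  ring_nf

/-- **Slice Laplacian of the self-similar test field**: for `Φ ∈ C²`,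
`Δ(ψ s)(y) = (θ(s) c(s)⁴) • (ΔΦ)(c(s) y)`. [folklore] -/
theorem laplacian_selfSimilarTest (θ : ℝ → ℝ)
    {Φ : EuclideanSpace ℝ (Fin 3) → EuclideanSpace ℝ (Fin 3)} (hΦ : ContDiff ℝ 2 Φ) (s : ℝ)
    (y : EuclideanSpace ℝ (Fin 3)) :
    (Δ (fun y => (θ s * (Real.sqrt (2 * (1 / 2) * (0 - s)))⁻¹) •
        lerayBackward (1 / 2) 0 Φ s y)) y =
      (θ s * ((Real.sqrt (2 * (1 / 2) * (0 - s)))⁻¹) ^ 4) •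
        (Δ Φ) ((Real.sqrt (2 * (1 / 2) * (0 - s)))⁻¹ • y) := by
  set c : ℝ := (Real.sqrt (2 * (1 / 2) * (0 - s)))⁻¹ with hc
  have h : (fun y => (θ s * c) • lerayBackward (1 / 2) 0 Φ s y) =
      (θ s * c) • lerayBackward (1 / 2) 0 Φ s := rfl
  have hLB : ContDiff ℝ 2 (lerayBackward (1 / 2) 0 Φ s) := by
    have : lerayBackward (1 / 2) 0 Φ s = fun y => c • Φ (c • y) := by
      funext y; simp [lerayBackward_apply, hc]
    rw [this]
    exact (hΦ.comp (contDiff_const_smul c)).const_smul c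
  rw [h, InnerProductSpace.laplacian_smul _ hLB.contDiffAt, laplacian_lerayBackward hΦ, smul_smul,
    ← hc]
  ring_nf

/-- **Time derivative of the self-similar test field**: for `s < 0`, `θ` differentiable and
`Φ ∈ C¹`, `∂ₛψ(s, y) = (θ(s) c(s)) • ((½ c(s)³) • (Φ(w) + DΦ(w) w)) +
(θ'(s) c(s) + ½ θ(s) c(s)³) • u_Φ(s, y)`, `w = c(s) y`, `u_Φ = lerayBackward ½ 0 Φ`
(product rule with `c' = ½ c³` and the time line of `lerayBackward`). [folklore] -/
theorem hasDerivAt_selfSimilarTest {θ : ℝ → ℝ} {θ' : ℝ} {s : ℝ} (hθ : HasDerivAt θ θ' s)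
    (hs : s < 0) {Φ : EuclideanSpace ℝ (Fin 3) → EuclideanSpace ℝ (Fin 3)} (hΦ : ContDiff ℝ 1 Φ)
    (y : EuclideanSpace ℝ (Fin 3)) :
    HasDerivAt (fun σ => (θ σ * (Real.sqrt (2 * (1 / 2) * (0 - σ)))⁻¹) •
        lerayBackward (1 / 2) 0 Φ σ y)
      ((θ s * (Real.sqrt (2 * (1 / 2) * (0 - s)))⁻¹) •
          ((1 / 2 * ((Real.sqrt (2 * (1 / 2) * (0 - s)))⁻¹) ^ 3) •
            (Φ ((Real.sqrt (2 * (1 / 2) * (0 - s)))⁻¹ • y) +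
              fderiv ℝ Φ ((Real.sqrt (2 * (1 / 2) * (0 - s)))⁻¹ • y)
                ((Real.sqrt (2 * (1 / 2) * (0 - s)))⁻¹ • y))) +
        (θ' * (Real.sqrt (2 * (1 / 2) * (0 - s)))⁻¹ +
          θ s * (1 / 2 * ((Real.sqrt (2 * (1 / 2) * (0 - s)))⁻¹) ^ 3)) •
          lerayBackward (1 / 2) 0 Φ s y) s := by
  have ha : (0 : ℝ) < 1 / 2 := by norm_num
  have hc := hasDerivAt_lerayScale (T := 0) ha hs
  have h1 : HasDerivAt (fun σ => θ σ * (Real.sqrt (2 * (1 / 2) * (0 - σ)))⁻¹)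
      (θ' * (Real.sqrt (2 * (1 / 2) * (0 - s)))⁻¹ +
        θ s * (1 / 2 * ((Real.sqrt (2 * (1 / 2) * (0 - s)))⁻¹) ^ 3)) s := hθ.mul hc
  have h2 := hasDerivAt_lerayBackward_time (T := 0) ha hs hΦ y
  exact h1.smul h2

/-- The slices of the self-similar test field are divergence free when `Φ` is. [folklore] -/
theorem isDivFree_selfSimilarTest (θ : ℝ → ℝ)
    {Φ : EuclideanSpace ℝ (Fin 3) → EuclideanSpace ℝ (Fin 3)} (hΦ : VectorCalculus.IsDivFree Φ)
    (s : ℝ) :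
    VectorCalculus.IsDivFree (fun y => (θ s * (Real.sqrt (2 * (1 / 2) * (0 - s)))⁻¹) •
        lerayBackward (1 / 2) 0 Φ s y) := by
  intro y
  simp only [VectorCalculus.divergence, fderiv_selfSimilarTest, ContinuousLinearMap.toLinearMap_smul,
    map_smul, smul_eq_mul]
  rw [show LinearMap.trace ℝ _ (fderiv ℝ Φ ((Real.sqrt (2 * (1 / 2) * (0 - s)))⁻¹ • y) :
      EuclideanSpace ℝ (Fin 3) →ₗ[ℝ] EuclideanSpace ℝ (Fin 3)) = 0 from hΦ _, mul_zero]

/-- **The self-similar test field is a space–time test field on the slab `(−1, 0) × ℝ³`** when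
`θ` is smooth with support in `[a, b] ⊂ (−1, 0)` and `Φ` is a spatial test field: it is smooth
on `{s < 0}` (the scale factor is smooth there) and vanishes on `{s > b}`; its support lies in
`[a, b] × B(0, R)` if `supp Φ ⊆ B(0, R)` (for `s ∈ [a, b]`, `c(s) ≥ 1`). [folklore] -/
theorem isSpaceTimeTestOn_selfSimilarTest {θ : ℝ → ℝ} (hθ : ContDiff ℝ (⊤ : ℕ∞) θ) {a b : ℝ}
    (ha : -1 < a) (hb : b < 0) (hθs : tsupport θ ⊆ Icc a b)
    {Φ : EuclideanSpace ℝ (Fin 3) → EuclideanSpace ℝ (Fin 3)}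
    (hΦ : FunctionSpaces.IsTestFunctionOn (⊤ : Opens (EuclideanSpace ℝ (Fin 3))) Φ) :
    IsSpaceTimeTestOn (slab (EuclideanSpace ℝ (Fin 3)) (Ioo (-1) 0) isOpen_Ioo)
      (fun s y => (θ s * (Real.sqrt (2 * (1 / 2) * (0 - s)))⁻¹) •
        lerayBackward (1 / 2) 0 Φ s y) := by
  have ha2 : (0 : ℝ) < 1 / 2 := by norm_num
  set ψ : ℝ → EuclideanSpace ℝ (Fin 3) → EuclideanSpace ℝ (Fin 3) := fun s y =>
    (θ s * (Real.sqrt (2 * (1 / 2) * (0 - s)))⁻¹) • lerayBackward (1 / 2) 0 Φ s y with hψ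
  -- `θ = 0` off `[a, b]`
  have hθ0 : ∀ s, s ∉ Icc a b → θ s = 0 := fun s hs =>
    image_eq_zero_of_notMem_tsupport fun h => hs (hθs h)
  -- support of `Φ`
  obtain ⟨R, hR0, hR⟩ : ∃ R, 0 < R ∧ tsupport Φ ⊆ ball (0 : EuclideanSpace ℝ (Fin 3)) R :=
    hΦ.hasCompactSupport.isBounded.subset_ball_lt 0 0
  -- the support of `ψ`
  have hsupp : support (uncurry ψ) ⊆ Icc a b ×ˢ closedBall (0 : EuclideanSpace ℝ (Fin 3)) R := by
    rintro ⟨s, y⟩ hp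
    rw [mem_support] at hp
    have hs : s ∈ Icc a b := by
      by_contra h
      exact hp (by simp [hψ, hθ0 s h])
    refine ⟨hs, ?_⟩
    have hs0 : s < 0 := hs.2.trans_lt hb
    set c : ℝ := (Real.sqrt (2 * (1 / 2) * (0 - s)))⁻¹ with hc
    have hc1 : 1 ≤ c := by
      have hcpos : 0 < c := lerayScale_pos (T := 0) ha2 hs0
      have hsq : c ^ 2 = (-s)⁻¹ := lerayScale_half_sq hs0
      have h1 : 1 ≤ c ^ 2 := by
        rw [hsq, one_le_inv₀ (by linarith)]
        linarith [hs.1]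
      nlinarith
    have hΦne : Φ (c • y) ≠ 0 := by
      intro h0
      have hc' : c = (Real.sqrt (-s))⁻¹ := by rw [hc]; norm_num
      rw [hc'] at h0
      exact hp (by simp [hψ, lerayBackward_apply, h0])
    have hcy : c • y ∈ ball (0 : EuclideanSpace ℝ (Fin 3)) R := hR (subset_tsupport _ hΦne)
    rw [mem_ball_zero_iff, norm_smul, Real.norm_eq_abs, abs_of_pos (by linarith)] at hcy
    rw [mem_closedBall_zero_iff]
    nlinarith [norm_nonneg y]
  refine ⟨?_, ?_, ?_⟩
  · -- smoothness: on `{s < 0}` by the formula, on `{s > b}` identically zero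
    rw [contDiff_iff_contDiffAt]
    rintro ⟨s, y⟩
    by_cases hs : s < 0
    · have hopen : IsOpen (Iio (0 : ℝ) ×ˢ (univ : Set (EuclideanSpace ℝ (Fin 3)))) :=
        isOpen_Iio.prod isOpen_univ
      have hon : ContDiffOn ℝ (⊤ : ℕ∞) (uncurry ψ) (Iio 0 ×ˢ univ) := by
        have h1 : ContDiffOn ℝ (⊤ : ℕ∞) (fun p : ℝ × EuclideanSpace ℝ (Fin 3) =>
            θ p.1 * (Real.sqrt (2 * (1 / 2) * (0 - p.1)))⁻¹) (Iio 0 ×ˢ univ) :=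
          (hθ.comp contDiff_fst).contDiffOn.mul
            ((contDiffOn_lerayScale (T := 0) ha2).comp contDiff_fst.contDiffOn fun p hp => hp.1)
        have h2 := contDiffOn_uncurry_lerayBackward (n := (⊤ : ℕ∞)) ha2 hΦ.contDiff 0
        exact h1.smul h2
      exact hon.contDiffAt (hopen.mem_nhds ⟨hs, mem_univ _⟩)
    · have hsb : b < s := hb.trans_le (not_lt.1 hs)
      have hnear : ∀ᶠ p : ℝ × EuclideanSpace ℝ (Fin 3) in 𝓝 (s, y), b < p.1 :=
        Filter.eventually_of_mem ((isOpen_Ioi.prod isOpen_univ).mem_nhds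
          (show (s, y) ∈ Ioi b ×ˢ (univ : Set (EuclideanSpace ℝ (Fin 3))) from
            ⟨hsb, mem_univ _⟩)) fun p hp => hp.1
      have hzero : uncurry ψ =ᶠ[𝓝 (s, y)] fun _ => 0 := by
        filter_upwards [hnear] with p hp
        obtain ⟨σ, w⟩ := p
        have : θ σ = 0 := hθ0 σ fun h => (not_le.2 hp) h.2
        simp [hψ, this]
      exact (contDiffAt_const.congr_of_eventuallyEq hzero)
  · exact HasCompactSupport.intro' ((isCompact_Icc.prod (isCompact_closedBall 0 R)))
      ((isClosed_Icc.prod isClosed_closedBall)) fun p hp => by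
        by_contra h
        exact hp (hsupp (mem_support.2 h))
  · intro p hp
    have hp' : p ∈ Icc a b ×ˢ closedBall (0 : EuclideanSpace ℝ (Fin 3)) R :=
      closure_minimal hsupp (isClosed_Icc.prod isClosed_closedBall) hp
    rw [SetLike.mem_coe, mem_slab]
    exact ⟨ha.trans_le hp'.1.1, hp'.1.2.trans_lt hb⟩

/-! ### The pairing of the limit field with a self-similar test field, slice by slice -/

section Pairing

variable {E : Type*} [NormedAddCommGroup E] [InnerProductSpace ℝ E] [FiniteDimensional ℝ E]
  [MeasurableSpace E] [BorelSpace E]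

/-- A measurable function vanishing off a ball and dominated there by `K(‖V‖ + ‖V‖²)` with
`V ∈ L²` of the ball is integrable. [folklore] -/
theorem integrable_of_bound_of_memLp_ball {h : E → ℝ} {V : E → E} {R K : ℝ}
    (hm : AEStronglyMeasurable h volume) (hzero : ∀ x, x ∉ ball (0 : E) R → h x = 0)
    (hV : MemLp V 2 (volume.restrict (ball (0 : E) R)))
    (hb : ∀ x ∈ ball (0 : E) R, ‖h x‖ ≤ K * (‖V x‖ + ‖V x‖ ^ 2)) : Integrable h volume := by
  have hsupp : support h ⊆ ball (0 : E) R := fun x hx => by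
    by_contra h'
    exact hx (hzero x h')
  rw [← integrableOn_iff_integrable_of_support_subset hsupp]
  haveI : IsFiniteMeasure (volume.restrict (ball (0 : E) R)) :=
    isFiniteMeasure_restrict.2 measure_ball_lt_top.ne
  have h1 : Integrable (fun x => ‖V x‖) (volume.restrict (ball (0 : E) R)) :=
    (hV.integrable one_le_two).norm
  have h2 : Integrable (fun x => ‖V x‖ ^ 2) (volume.restrict (ball (0 : E) R)) :=
    (memLp_two_iff_integrable_sq_norm hV.1).1 hV
  refine Integrable.mono' ((h1.add h2).const_mul K) hm.restrict ?_
  rw [ae_restrict_iff' measurableSet_ball]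
  exact Eventually.of_forall hb

end Pairing

section SlicePairing

variable {V Φ : EuclideanSpace ℝ (Fin 3) → EuclideanSpace ℝ (Fin 3)}

/-- `w ↦ ⟪V w, Φ w⟫` is integrable for `V ∈ L²_{loc}` and a spatial test field `Φ`. [folklore] -/
theorem integrable_inner_testField_of_memLp_loc (hΦ : FunctionSpaces.IsTestFunctionOn (⊤ : Opens (EuclideanSpace ℝ (Fin 3))) Φ)
    (hV : AEStronglyMeasurable V volume)
    (hV2 : ∀ R : ℝ, 0 < R → MemLp V 2 (volume.restrict (ball 0 R))) :
    Integrable (fun w => ⟪V w, Φ w⟫) volume := by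
  obtain ⟨R, hR0, hR⟩ : ∃ R, 0 < R ∧ tsupport Φ ⊆ ball (0 : EuclideanSpace ℝ (Fin 3)) R :=
    hΦ.hasCompactSupport.isBounded.subset_ball_lt 0 0
  obtain ⟨K₀, hK₀⟩ : ∃ K, ∀ x, ‖Φ x‖ ≤ K :=
    hΦ.contDiff.continuous.bounded_above_of_compact_support hΦ.hasCompactSupport
  have hΦ0 : ∀ x, x ∉ ball (0 : EuclideanSpace ℝ (Fin 3)) R → Φ x = 0 := fun x hx =>
    image_eq_zero_of_notMem_tsupport fun h => hx (hR h)
  have hK0' : 0 ≤ K₀ := (norm_nonneg _).trans (hK₀ 0)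
  have hb : ∀ x ∈ ball (0 : EuclideanSpace ℝ (Fin 3)) R,
      ‖⟪V x, Φ x⟫‖ ≤ K₀ * (‖V x‖ + ‖V x‖ ^ 2) := by
    intro x _
    rw [Real.norm_eq_abs]
    have h1 : |⟪V x, Φ x⟫| ≤ ‖V x‖ * K₀ :=
      (abs_real_inner_le_norm _ _).trans (mul_le_mul_of_nonneg_left (hK₀ x) (norm_nonneg _))
    nlinarith [norm_nonneg (V x), sq_nonneg ‖V x‖]
  exact integrable_of_bound_of_memLp_ball (hV.inner hΦ.contDiff.continuous.aestronglyMeasurable)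
    (fun x hx => by rw [hΦ0 x hx, inner_zero_right]) (hV2 R hR0) hb

set_option maxHeartbeats 800000 in
/-- The integrand of the Leray functional,
`⟪V, ΔΦ⟫ + ⟪V, Φ⟫ + ½⟪V, DΦ(w) w⟫ + ⟪V, DΦ(w)(V w)⟫`, is integrable for `V ∈ L²_{loc}` and a
spatial test field `Φ`. [folklore] -/
theorem integrable_lerayFunctional_integrand
    (hΦ : FunctionSpaces.IsTestFunctionOn (⊤ : Opens (EuclideanSpace ℝ (Fin 3))) Φ)
    (hV : AEStronglyMeasurable V volume)
    (hV2 : ∀ R : ℝ, 0 < R → MemLp V 2 (volume.restrict (ball 0 R))) :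
    Integrable (fun w => ⟪V w, (Δ Φ) w⟫ + ⟪V w, Φ w⟫ + 1 / 2 * ⟪V w, fderiv ℝ Φ w w⟫ +
      ⟪V w, fderiv ℝ Φ w (V w)⟫) volume := by
  have hΦ2 : ContDiff ℝ 2 Φ := hΦ.contDiff.of_le (by norm_cast)
  have hΦ1 : ContDiff ℝ 1 Φ := hΦ.contDiff.of_le (by norm_cast)
  obtain ⟨R, hR0, hR⟩ : ∃ R, 0 < R ∧ tsupport Φ ⊆ ball (0 : EuclideanSpace ℝ (Fin 3)) R :=
    hΦ.hasCompactSupport.isBounded.subset_ball_lt 0 0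
  obtain ⟨K₀, hK₀⟩ : ∃ K, ∀ x, ‖Φ x‖ ≤ K :=
    hΦ.contDiff.continuous.bounded_above_of_compact_support hΦ.hasCompactSupport
  have hDc : Continuous (fderiv ℝ Φ) := hΦ1.continuous_fderiv one_ne_zero
  have hDcs : HasCompactSupport (fderiv ℝ Φ) := hΦ.hasCompactSupport.fderiv (𝕜 := ℝ)
  obtain ⟨K₁, hK₁⟩ : ∃ K, ∀ x, ‖fderiv ℝ Φ x‖ ≤ K := hDc.bounded_above_of_compact_support hDcs
  have hLc : Continuous (Δ Φ) := continuous_laplacian hΦ2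
  have hLcs : HasCompactSupport (Δ Φ) :=
    HasCompactSupport.intro hΦ.hasCompactSupport fun x hx => laplacian_eq_zero_of_notMem_tsupport hx
  obtain ⟨K₂, hK₂⟩ : ∃ K, ∀ x, ‖(Δ Φ) x‖ ≤ K := hLc.bounded_above_of_compact_support hLcs
  have hΦ0 : ∀ x, x ∉ ball (0 : EuclideanSpace ℝ (Fin 3)) R → Φ x = 0 := fun x hx =>
    image_eq_zero_of_notMem_tsupport fun h => hx (hR h)
  have hD0 : ∀ x, x ∉ ball (0 : EuclideanSpace ℝ (Fin 3)) R → fderiv ℝ Φ x = 0 := fun x hx => by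
    have h0 : Φ =ᶠ[𝓝 x] fun _ => 0 := notMem_tsupport_iff_eventuallyEq.1 fun h => hx (hR h)
    rw [h0.fderiv_eq, fderiv_fun_const, Pi.zero_apply]
  have hL0 : ∀ x, x ∉ ball (0 : EuclideanSpace ℝ (Fin 3)) R → (Δ Φ) x = 0 := fun x hx =>
    laplacian_eq_zero_of_notMem_tsupport fun h => hx (hR h)
  have happ : Continuous fun p : (EuclideanSpace ℝ (Fin 3) →L[ℝ] EuclideanSpace ℝ (Fin 3)) ×
      EuclideanSpace ℝ (Fin 3) => p.1 p.2 :=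
    (isBoundedBilinearMap_apply (𝕜 := ℝ) (E := EuclideanSpace ℝ (Fin 3))
      (F := EuclideanSpace ℝ (Fin 3))).continuous
  -- measurability
  have hm1 : AEStronglyMeasurable (fun w => ⟪V w, (Δ Φ) w⟫) volume :=
    hV.inner hLc.aestronglyMeasurable
  have hm2 : AEStronglyMeasurable (fun w => ⟪V w, Φ w⟫) volume :=
    hV.inner hΦ.contDiff.continuous.aestronglyMeasurable
  have hm3' : AEStronglyMeasurable (fun w => fderiv ℝ Φ w w) volume :=
    (happ.comp (hDc.prodMk continuous_id)).aestronglyMeasurable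
  have hm3 : AEStronglyMeasurable (fun w => 1 / 2 * ⟪V w, fderiv ℝ Φ w w⟫) volume :=
    (hV.inner hm3').const_mul _
  have hm4' : AEStronglyMeasurable (fun w => fderiv ℝ Φ w (V w)) volume :=
    happ.comp_aestronglyMeasurable (hDc.aestronglyMeasurable.prodMk hV)
  have hm4 : AEStronglyMeasurable (fun w => ⟪V w, fderiv ℝ Φ w (V w)⟫) volume := hV.inner hm4'
  -- the bound on the ball
  have hK0' : 0 ≤ K₀ := (norm_nonneg _).trans (hK₀ 0)
  have hK1' : 0 ≤ K₁ := (norm_nonneg _).trans (hK₁ 0)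
  have hK2' : 0 ≤ K₂ := (norm_nonneg _).trans (hK₂ 0)
  have hb : ∀ x ∈ ball (0 : EuclideanSpace ℝ (Fin 3)) R,
      ‖⟪V x, (Δ Φ) x⟫ + ⟪V x, Φ x⟫ + 1 / 2 * ⟪V x, fderiv ℝ Φ x x⟫ + ⟪V x, fderiv ℝ Φ x (V x)⟫‖ ≤
        (K₂ + K₀ + 1 / 2 * (K₁ * R) + K₁) * (‖V x‖ + ‖V x‖ ^ 2) := by
    intro x hx
    have hxR : ‖x‖ ≤ R := (mem_ball_zero_iff.1 hx).le
    rw [Real.norm_eq_abs]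
    have e1 : |⟪V x, (Δ Φ) x⟫| ≤ ‖V x‖ * K₂ :=
      (abs_real_inner_le_norm _ _).trans (mul_le_mul_of_nonneg_left (hK₂ x) (norm_nonneg _))
    have e2 : |⟪V x, Φ x⟫| ≤ ‖V x‖ * K₀ :=
      (abs_real_inner_le_norm _ _).trans (mul_le_mul_of_nonneg_left (hK₀ x) (norm_nonneg _))
    have e3' : ‖fderiv ℝ Φ x x‖ ≤ K₁ * R :=
      ((fderiv ℝ Φ x).le_opNorm x).trans (mul_le_mul (hK₁ x) hxR (norm_nonneg _) hK1')
    have e3 : |⟪V x, fderiv ℝ Φ x x⟫| ≤ ‖V x‖ * (K₁ * R) :=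
      (abs_real_inner_le_norm _ _).trans (mul_le_mul_of_nonneg_left e3' (norm_nonneg _))
    have e4' : ‖fderiv ℝ Φ x (V x)‖ ≤ K₁ * ‖V x‖ :=
      ((fderiv ℝ Φ x).le_opNorm (V x)).trans (mul_le_mul_of_nonneg_right (hK₁ x) (norm_nonneg _))
    have e4 : |⟪V x, fderiv ℝ Φ x (V x)⟫| ≤ ‖V x‖ * (K₁ * ‖V x‖) :=
      (abs_real_inner_le_norm _ _).trans (mul_le_mul_of_nonneg_left e4' (norm_nonneg _))
    have e3'' : |1 / 2 * ⟪V x, fderiv ℝ Φ x x⟫| ≤ 1 / 2 * (‖V x‖ * (K₁ * R)) := by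
      rw [abs_mul, abs_of_pos (by norm_num : (0 : ℝ) < 1 / 2)]
      exact mul_le_mul_of_nonneg_left e3 (by norm_num)
    have hsum := abs_add_le (⟪V x, (Δ Φ) x⟫ + ⟪V x, Φ x⟫ + 1 / 2 * ⟪V x, fderiv ℝ Φ x x⟫)
      ⟪V x, fderiv ℝ Φ x (V x)⟫
    have hsum2 := abs_add_le (⟪V x, (Δ Φ) x⟫ + ⟪V x, Φ x⟫) (1 / 2 * ⟪V x, fderiv ℝ Φ x x⟫)
    have hsum3 := abs_add_le ⟪V x, (Δ Φ) x⟫ ⟪V x, Φ x⟫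
    nlinarith [norm_nonneg (V x), sq_nonneg ‖V x‖, mul_nonneg hK1' hR0.le]
  refine integrable_of_bound_of_memLp_ball (((hm1.add hm2).add hm3).add hm4) ?_ (hV2 R hR0) hb
  intro x hx
  simp only [hΦ0 x hx, hD0 x hx, hL0 x hx, inner_zero_right, _root_.zero_apply,
    mul_zero, add_zero]

set_option maxHeartbeats 400000 in
/-- **Separation of variables in the pairing** (the computation behind "`V̄` is a weak solution of
the Leray system", Chae 2007, arXiv p. 8, via the change of variables (3.13)): for `s < 0`, `θ`
differentiable at `s`, `Φ` a spatial test field and `V ∈ L²_{loc}`, the slice pairing of the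
backward self-similar field `u_V = lerayBackward ½ 0 V` with the self-similar test field
`ψ(s, y) = θ(s)(−s)⁻¹Φ(y/√(−s))` is
`∫ (⟪u_V, ∂ₛψ⟫ + ⟪u_V, (u_V·∇)ψ⟫ + ⟪u_V, Δψ⟫)(s, y) dy = θ'(s) ∫⟪V, Φ⟫ + θ(s)(−s)⁻¹ L(V, Φ)`,
with the **Leray functional**
`L(V, Φ) = ∫ (⟪V, ΔΦ⟫ + ⟪V, Φ⟫ + ½⟪V, (y·∇)Φ⟫ + ⟪V, (V·∇)Φ⟫) dy`
(every term is a function of `w = y/√(−s)`; substitute and collect the powers of the scale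
factor). [cite: Chae2007, proof of Thm 1.5 with (3.13) (arXiv p. 8)] -/
theorem integral_pairing_selfSimilarTest {θ : ℝ → ℝ} {θ' s : ℝ} (hθ : HasDerivAt θ θ' s)
    (hs : s < 0) (hΦ : FunctionSpaces.IsTestFunctionOn (⊤ : Opens (EuclideanSpace ℝ (Fin 3))) Φ)
    (hV : AEStronglyMeasurable V volume)
    (hV2 : ∀ R : ℝ, 0 < R → MemLp V 2 (volume.restrict (ball 0 R))) :
    ∫ y, (⟪lerayBackward (1 / 2) 0 V s y,
          timeDeriv (fun σ y => (θ σ * (Real.sqrt (2 * (1 / 2) * (0 - σ)))⁻¹) •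
            lerayBackward (1 / 2) 0 Φ σ y) s y⟫ +
        ⟪lerayBackward (1 / 2) 0 V s y,
          fderiv ℝ (fun y => (θ s * (Real.sqrt (2 * (1 / 2) * (0 - s)))⁻¹) •
            lerayBackward (1 / 2) 0 Φ s y) y (lerayBackward (1 / 2) 0 V s y)⟫ +
        ⟪lerayBackward (1 / 2) 0 V s y,
          (Δ (fun y => (θ s * (Real.sqrt (2 * (1 / 2) * (0 - s)))⁻¹) •
            lerayBackward (1 / 2) 0 Φ s y)) y⟫) =
      θ' * (∫ w, ⟪V w, Φ w⟫) + θ s * (-s)⁻¹ *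
        ∫ w, (⟪V w, (Δ Φ) w⟫ + ⟪V w, Φ w⟫ + 1 / 2 * ⟪V w, fderiv ℝ Φ w w⟫ +
          ⟪V w, fderiv ℝ Φ w (V w)⟫) := by
  have ha : (0 : ℝ) < 1 / 2 := by norm_num
  set c : ℝ := (Real.sqrt (2 * (1 / 2) * (0 - s)))⁻¹ with hc
  have hcpos : 0 < c := lerayScale_pos (T := 0) ha hs
  have hc2 : c ^ 2 = (-s)⁻¹ := lerayScale_half_sq hs
  have hΦ2 : ContDiff ℝ 2 Φ := hΦ.contDiff.of_le (by norm_cast)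
  have hΦ1 : ContDiff ℝ 1 Φ := hΦ.contDiff.of_le (by norm_cast)
  -- the integrand as a function of `w = c • y`
  set G : EuclideanSpace ℝ (Fin 3) → ℝ := fun w => c ^ 3 * θ' * ⟪V w, Φ w⟫ +
    c ^ 5 * θ s * (⟪V w, (Δ Φ) w⟫ + ⟪V w, Φ w⟫ + 1 / 2 * ⟪V w, fderiv ℝ Φ w w⟫ +
      ⟪V w, fderiv ℝ Φ w (V w)⟫) with hG
  have hpt : ∀ y, (⟪lerayBackward (1 / 2) 0 V s y,
          timeDeriv (fun σ y => (θ σ * (Real.sqrt (2 * (1 / 2) * (0 - σ)))⁻¹) •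
            lerayBackward (1 / 2) 0 Φ σ y) s y⟫ +
        ⟪lerayBackward (1 / 2) 0 V s y,
          fderiv ℝ (fun y => (θ s * (Real.sqrt (2 * (1 / 2) * (0 - s)))⁻¹) •
            lerayBackward (1 / 2) 0 Φ s y) y (lerayBackward (1 / 2) 0 V s y)⟫ +
        ⟪lerayBackward (1 / 2) 0 V s y,
          (Δ (fun y => (θ s * (Real.sqrt (2 * (1 / 2) * (0 - s)))⁻¹) •
            lerayBackward (1 / 2) 0 Φ s y)) y⟫) = G (c • y) := by
    intro y
    rw [timeDeriv_apply, (hasDerivAt_selfSimilarTest hθ hs hΦ1 y).deriv, fderiv_selfSimilarTest,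
      laplacian_selfSimilarTest θ hΦ2]
    simp only [lerayBackward_apply, ← hc, hG]
    simp only [real_inner_smul_left, real_inner_smul_right, inner_add_right, map_smul,
      _root_.smul_apply, smul_add, smul_smul]
    ring_nf
  refine Eq.trans (integral_congr_ae (Eventually.of_forall hpt)) ?_
  rw [Measure.integral_comp_smul volume G c, finrank_euclideanSpace_fin,
    abs_of_pos (inv_pos.2 (pow_pos hcpos 3)), smul_eq_mul]
  -- integrability of the two parts of `G`
  have hint1 := integrable_inner_testField_of_memLp_loc hΦ hV hV2
  have hint2 := integrable_lerayFunctional_integrand hΦ hV hV2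
  -- linearity and the powers of `c`
  have hsplit : ∫ w, G w = c ^ 3 * θ' * (∫ w, ⟪V w, Φ w⟫) + c ^ 5 * θ s *
      ∫ w, (⟪V w, (Δ Φ) w⟫ + ⟪V w, Φ w⟫ + 1 / 2 * ⟪V w, fderiv ℝ Φ w w⟫ +
        ⟪V w, fderiv ℝ Φ w (V w)⟫) := by
    simp only [hG]
    rw [integral_add (hint1.const_mul _) (hint2.const_mul _), integral_const_mul, integral_const_mul]
  rw [hsplit, ← hc2]
  have hc0 : c ≠ 0 := hcpos.ne'
  field_simp
  ring_nf

end SlicePairing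

/-! ### The time integral: `∫ θ' = 0` and the weight `∫ θ(s)(−s)⁻¹ ds` -/

section TimeIntegral

/-- The weight function `s ↦ θ(s)(−s)⁻¹` of a smooth cut-off supported in `[a, b]`, `b < 0`, is
continuous on `ℝ` (it vanishes near `s ≥ 0`). [folklore] -/
theorem continuous_mul_inv_neg_of_tsupport {θ : ℝ → ℝ} (hθ : Continuous θ) {a b : ℝ} (hb : b < 0)
    (hθs : tsupport θ ⊆ Icc a b) : Continuous fun s => θ s * (-s)⁻¹ := by
  have hθ0 : ∀ s, s ∉ Icc a b → θ s = 0 := fun s hs =>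
    image_eq_zero_of_notMem_tsupport fun h => hs (hθs h)
  rw [continuous_iff_continuousAt]
  intro s
  by_cases hs : s ≤ b
  · have hs0 : -s ≠ 0 := by linarith
    exact hθ.continuousAt.mul ((continuous_neg.continuousAt).inv₀ hs0)
  · have hnear : ∀ᶠ σ in 𝓝 s, b < σ := Ioi_mem_nhds (not_le.1 hs)
    have hzero : (fun σ => θ σ * (-σ)⁻¹) =ᶠ[𝓝 s] fun _ => 0 := by
      filter_upwards [hnear] with σ hσ
      rw [hθ0 σ fun h => (not_le.2 hσ) h.2, zero_mul]
    exact continuousAt_const.congr hzero.symm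

/-- **The time integral of the separated pairing**: for a smooth cut-off `θ` supported in
`[a, b] ⊂ (−1, 0)` and constants `A, L`,
`∫_{−1}^0 (θ'(s) A + θ(s)(−s)⁻¹ L) ds = L ∫_{−1}^0 θ(s)(−s)⁻¹ ds` (`∫ θ' = 0` for compactly
supported `θ`). [folklore] -/
theorem integral_time_selfSimilarTest {θ : ℝ → ℝ} (hθ : ContDiff ℝ (⊤ : ℕ∞) θ) {a b : ℝ}
    (ha : -1 < a) (hb : b < 0) (hθs : tsupport θ ⊆ Icc a b) (A L : ℝ) :
    ∫ s in Ioo (-1 : ℝ) 0, (deriv θ s * A + θ s * (-s)⁻¹ * L) =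
      L * ∫ s in Ioo (-1 : ℝ) 0, θ s * (-s)⁻¹ := by
  have hθc : Continuous θ := hθ.continuous
  have hθcs : HasCompactSupport θ :=
    HasCompactSupport.of_support_subset_isCompact isCompact_Icc
      ((subset_tsupport θ).trans hθs)
  have hdc : Continuous (deriv θ) := hθ.continuous_deriv (by simp)
  have hdcs : HasCompactSupport (deriv θ) := hθcs.deriv
  have hθ0 : ∀ s, s ∉ Icc a b → θ s = 0 := fun s hs =>
    image_eq_zero_of_notMem_tsupport fun h => hs (hθs h)
  -- `∫ θ' = 0`
  have hderiv0 : ∫ s in Ioo (-1 : ℝ) 0, deriv θ s = 0 := by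
    rw [setIntegral_eq_integral_of_forall_compl_eq_zero]
    · exact integral_eq_zero_of_hasDerivAt_of_integrable
        (fun x => ((hθ.differentiable (by simp)) x).hasDerivAt)
        (hdc.integrable_of_hasCompactSupport hdcs) (hθc.integrable_of_hasCompactSupport hθcs)
    · intro s hs
      have hs' : s ∉ tsupport θ := fun h => hs ⟨ha.trans_le (hθs h).1, (hθs h).2.trans_lt hb⟩
      have h0 : θ =ᶠ[𝓝 s] fun _ => 0 := notMem_tsupport_iff_eventuallyEq.1 hs'
      rw [h0.deriv_eq, deriv_const]
  -- integrability on `(−1, 0)`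
  have hp : Continuous fun s => θ s * (-s)⁻¹ := continuous_mul_inv_neg_of_tsupport hθc hb hθs
  have hI1 : IntegrableOn (fun s => deriv θ s * A) (Ioo (-1 : ℝ) 0) volume :=
    ((hdc.mul continuous_const).integrableOn_Icc (a := -1) (b := 0)).mono_set Ioo_subset_Icc_self
  have hI2 : IntegrableOn (fun s => θ s * (-s)⁻¹ * L) (Ioo (-1 : ℝ) 0) volume :=
    ((hp.mul continuous_const).integrableOn_Icc (a := -1) (b := 0)).mono_set Ioo_subset_Icc_self
  rw [integral_add hI1 hI2, integral_mul_const, integral_mul_const, hderiv0, zero_mul, zero_add,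
    mul_comm]

/-- A concrete admissible cut-off: the smooth bump `θ₀` centred at `−½` with radii `⅛ ≤ ¼` is
supported in `[−¾, −¼]`, and its weight is positive: `∫_{−1}^0 θ₀(s)(−s)⁻¹ ds ≥ ¼ > 0`
(`θ₀ = 1` and `(−s)⁻¹ ≥ 1` on `[−⅝, −⅜]`). [folklore] -/
theorem exists_bump_weight_pos :
    ∃ θ : ℝ → ℝ, ContDiff ℝ (⊤ : ℕ∞) θ ∧ tsupport θ ⊆ Icc (-(3 / 4)) (-(1 / 4)) ∧
      0 < ∫ s in Ioo (-1 : ℝ) 0, θ s * (-s)⁻¹ := by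
  let f : ContDiffBump (-(1 / 2) : ℝ) := ⟨1 / 8, 1 / 4, by norm_num, by norm_num⟩
  refine ⟨f, f.contDiff, ?_, ?_⟩
  · rw [f.tsupport_eq, Real.closedBall_eq_Icc]
    norm_num
  · have hsupp : tsupport (f : ℝ → ℝ) ⊆ Icc (-(3 / 4)) (-(1 / 4)) := by
      rw [f.tsupport_eq, Real.closedBall_eq_Icc]
      norm_num
    have hp : Continuous fun s => f s * (-s)⁻¹ :=
      continuous_mul_inv_neg_of_tsupport f.continuous (by norm_num) hsupp
    have hInt : IntegrableOn (fun s => f s * (-s)⁻¹) (Ioo (-1 : ℝ) 0) volume :=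
      (hp.integrableOn_Icc (a := -1) (b := 0)).mono_set Ioo_subset_Icc_self
    have hnonneg : ∀ s ∈ Ioo (-1 : ℝ) 0, 0 ≤ f s * (-s)⁻¹ := fun s hs =>
      mul_nonneg f.nonneg (inv_nonneg.2 (by linarith [hs.2]))
    have hsub : Icc (-(5 / 8) : ℝ) (-(3 / 8)) ⊆ Ioo (-1 : ℝ) 0 := fun s hs =>
      ⟨by linarith [hs.1], by linarith [hs.2]⟩
    have hone : ∀ s ∈ Icc (-(5 / 8) : ℝ) (-(3 / 8)), (1 : ℝ) ≤ f s * (-s)⁻¹ := by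
      intro s hs
      have h1 : f s = 1 := by
        apply f.one_of_mem_closedBall
        rw [Real.closedBall_eq_Icc]
        exact ⟨by norm_num; linarith [hs.1], by norm_num; linarith [hs.2]⟩
      rw [h1, one_mul, one_le_inv₀ (by linarith [hs.2])]
      linarith [hs.1]
    calc (0 : ℝ) < 1 / 4 := by norm_num
      _ = ∫ _ in Icc (-(5 / 8) : ℝ) (-(3 / 8)), (1 : ℝ) := by
          rw [setIntegral_const]
          simp [Measure.real, Real.volume_Icc]
          norm_num
      _ ≤ ∫ s in Icc (-(5 / 8) : ℝ) (-(3 / 8)), f s * (-s)⁻¹ :=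
          setIntegral_mono_on (integrableOn_const (by simp [Real.volume_Icc]))
            (hInt.mono_set hsub) measurableSet_Icc hone
      _ ≤ ∫ s in Ioo (-1 : ℝ) 0, f s * (-s)⁻¹ :=
          setIntegral_mono_set hInt ((ae_restrict_iff' measurableSet_Ioo).2
            (Eventually.of_forall hnonneg)) (Eventually.of_forall hsub)

end TimeIntegral

end SelfSimilarTest


/-! ### Chae 2007, proof of Theorem 1.5: `V̄` is a very weak solution of Leray's system -/

section LerayVeryWeak

variable {T : ℝ} {z : EuclideanSpace ℝ (Fin 3)} {q : ℝ≥0}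
  {v : ℝ → EuclideanSpace ℝ (Fin 3) → EuclideanSpace ℝ (Fin 3)}
  {π : ℝ → EuclideanSpace ℝ (Fin 3) → ℝ}
  {V : EuclideanSpace ℝ (Fin 3) → EuclideanSpace ℝ (Fin 3)}

/-- **The profile is a very weak solution of Leray's system** (Chae 2007, proof of Thm 1.5,
arXiv p. 8: "we can conclude that `V̄` is a weak solution of the Leray system (3.6)
[`½V̄ + ½(y·∇)V̄ + (V̄·∇)V̄ = −∇P̄ + ΔV̄`, `div V̄ = 0`, after Chae's factor-2 normalisation;
NRŠ 1996, (1.4)–(1.5) with `a = ½`]. We note here that `L^q_{loc}(ℝ³)` convergence with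
`q ∈ [2, ∞)` is enough"). Under the convergence of the blow-up rescalings
(`tendsto_iSup_nsRescale_sub_lerayBackward`, from hypothesis (1.15) for all `R`), for every smooth
compactly supported divergence-free field `Φ`,
`∫ (⟪V̄, ΔΦ⟫ + ⟪V̄, Φ⟫ + ½⟪V̄, (y·∇)Φ⟫ + ⟪V̄, (V̄·∇)Φ⟫) dy = 0`
— the distributional form, tested against divergence-free fields, of
`−ΔV̄ + ½V̄ + ½(y·∇)V̄ + (V̄·∇)V̄ + ∇P̄ = 0` (`(y·∇)Φ = DΦ(y) y`, `(V̄·∇)Φ = DΦ(y)(V̄ y)`; together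
with `isWeaklyDivFree_profile_of_tendsto` this is the very weak Leray system for
`V̄ ∈ L^p ∩ L^q_{loc}`). Proof: test the space–time identity
`weakIdentity_lerayBackward_of_tendsto` with the self-similar field
`ψ(s, y) = θ(s)(−s)⁻¹Φ(y/√(−s))` (`isSpaceTimeTestOn_selfSimilarTest`); slice by slice the pairing
separates as `θ'(s)∫⟪V̄, Φ⟫ + θ(s)(−s)⁻¹ L(V̄, Φ)` (`integral_pairing_selfSimilarTest`), whose time
integral is `L(V̄, Φ) ∫θ(s)(−s)⁻¹ds` (`integral_time_selfSimilarTest`); a bump `θ ≥ 0` makes the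
weight positive (`exists_bump_weight_pos`), so `L(V̄, Φ) = 0`.
[cite: Chae2007, proof of Thm 1.5 (arXiv p. 8), Leray system (3.6)] -/
theorem lerayVeryWeak_profile_of_tendsto (hT : 0 < T)
    (hv : IsClassicalNSSolutionOn (Ioo 0 T) 1 0 v π) (hq : 2 ≤ q)
    (hV : AEStronglyMeasurable V volume)
    (hlim : ∀ R : ℝ, 0 < R → Tendsto (fun l : ℝ => ⨆ s ∈ Ioo (-1 : ℝ) 0, eLpNorm
        (fun y => nsRescale l (fun τ x => v (T + τ) (z + x)) s y - lerayBackward (1 / 2) 0 V s y)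
        (q : ℝ≥0∞) (volume.restrict (ball 0 R))) (𝓝[>] 0) (𝓝 0))
    {Φ : EuclideanSpace ℝ (Fin 3) → EuclideanSpace ℝ (Fin 3)}
    (hΦ : FunctionSpaces.IsTestFunctionOn (⊤ : Opens (EuclideanSpace ℝ (Fin 3))) Φ)
    (hΦdiv : VectorCalculus.IsDivFree Φ) :
    ∫ w, (⟪V w, (Δ Φ) w⟫ + ⟪V w, Φ w⟫ + 1 / 2 * ⟪V w, fderiv ℝ Φ w w⟫ +
      ⟪V w, fderiv ℝ Φ w (V w)⟫) = 0 := by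
  -- `V ∈ L²_{loc}`
  have hV2 : ∀ R : ℝ, 0 < R → MemLp V 2 (volume.restrict (ball 0 R)) := by
    intro R hR
    haveI : IsFiniteMeasure (volume.restrict (ball (0 : EuclideanSpace ℝ (Fin 3)) R)) :=
      isFiniteMeasure_restrict.2 measure_ball_lt_top.ne
    exact (memLp_profile_restrict_ball_of_tendsto hT hv hq hV hlim hR).mono_exponent
      (by exact_mod_cast hq)
  -- the cut-off and the self-similar test field
  obtain ⟨θ, hθ, hθs, hθpos⟩ := exists_bump_weight_pos
  have ha : (-1 : ℝ) < -(3 / 4) := by norm_num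
  have hb : (-(1 / 4) : ℝ) < 0 := by norm_num
  have hψ := isSpaceTimeTestOn_selfSimilarTest hθ ha hb hθs hΦ
  have hψdiv := isDivFree_selfSimilarTest θ hΦdiv
  -- the space–time identity for `ψ`
  obtain ⟨-, hzero⟩ := weakIdentity_lerayBackward_of_tendsto hT hv hq hV hlim hψ hψdiv
  -- slice by slice, the pairing separates
  set L : ℝ := ∫ w, (⟪V w, (Δ Φ) w⟫ + ⟪V w, Φ w⟫ + 1 / 2 * ⟪V w, fderiv ℝ Φ w w⟫ +
    ⟪V w, fderiv ℝ Φ w (V w)⟫) with hL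
  set A : ℝ := ∫ w, ⟪V w, Φ w⟫ with hA
  have hslice : ∀ s ∈ Ioo (-1 : ℝ) 0,
      (∫ y, (⟪lerayBackward (1 / 2) 0 V s y,
          timeDeriv (fun σ y => (θ σ * (Real.sqrt (2 * (1 / 2) * (0 - σ)))⁻¹) •
            lerayBackward (1 / 2) 0 Φ σ y) s y⟫ +
        ⟪lerayBackward (1 / 2) 0 V s y, convect (lerayBackward (1 / 2) 0 V s)
          ((fun σ y => (θ σ * (Real.sqrt (2 * (1 / 2) * (0 - σ)))⁻¹) •
            lerayBackward (1 / 2) 0 Φ σ y) s) y⟫ +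
        ⟪lerayBackward (1 / 2) 0 V s y,
          (Δ ((fun σ y => (θ σ * (Real.sqrt (2 * (1 / 2) * (0 - σ)))⁻¹) •
            lerayBackward (1 / 2) 0 Φ σ y) s)) y⟫)) = deriv θ s * A + θ s * (-s)⁻¹ * L := by
    intro s hs
    have key := integral_pairing_selfSimilarTest ((hθ.differentiable (by simp)) s).hasDerivAt
      hs.2 hΦ hV hV2
    simpa only [convect_apply] using key
  rw [setIntegral_congr_fun measurableSet_Ioo hslice,
    integral_time_selfSimilarTest hθ ha hb hθs A L] at hzero
  exact (mul_eq_zero.1 hzero).resolve_right hθpos.ne'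

end LerayVeryWeak

end Literature.Analysis.FluidPDE

end
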